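import Literature.Computability.AlgebraicComplexity.LMR13DualSchemeEquivariance
import Literature.Computability.AlgebraicComplexity.LMR13ComponentFromTangent
import Literature.Computability.AlgebraicComplexity.LMR13ImmanantsTangent
import Literature.Computability.AlgebraicComplexity.LMR13ImmanantFourTermRelations
import Literature.Computability.AlgebraicComplexity.LMR13StabilizerDimensions
import Literature.Computability.AlgebraicComplexity.PermanentIrreducible
import Literature.Computability.AlgebraicComplexity.DeterminantIrreducible
import Literature.RepresentationTheory.FiniteGroups.SymmetricGroupIsotypic
import Literature.RepresentationTheory.FiniteGroups.GroupAlgebraTwoSidedIdeals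
import Mathlib.RingTheory.MvPolynomial.WeightedHomogeneous
import HarnessLib

/-!
# LMR 2013 Thm. 3.1.1, the isotypic step: `T̂_{[det_n]}𝒟ual_{2n−2,n,n²} ⊆ 𝔤𝔩(W)·det_n` — PROVED,
# hence `LMR2013_thm_3_1_1_holds`

Cell `val-lit` (D-0074), row LMR13-A; `val-lit-t12` (g4). Companion of
`Literature/Computability/AlgebraicComplexity/LMR13DualVarieties.lean` (typed statements,
`val-lit-t11`). Landsberg–Manivel–Ressayre, *Hypersurfaces with degenerate duals and the Geometric
Complexity Theory Program*, Comment. Math. Helv. 88 (2013), Thm. 3.1.1 (journal p. 476; proof §3.3–§3.4,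
pp. 477–480; arXiv:1004.4802 `p0006.txt:L32–34`, `p0007.txt:L41–52`, `p0008.txt:L8–43`):

> "The scheme `𝒟ual_{2n−2,n,n²}` is smooth at `[det_n]`, and the `PGL_{n²}`-orbit closure of `[det_n]`
> is an irreducible component of `𝒟ual_{2n−2,n,n²}`." (Thm. 3.1.1) … "`T̂_{[det_n]}𝒟ual_{2n−2,n,n²}` is a
> `GL(E)×GL(F)`-submodule of `Sⁿ(E ⊗ F)^*`, which contains `𝔤𝔩(W)·det_n`. Recall the decomposition
> `Sⁿ(E⊗F) = ⊕_{|π|=n} S_πE ⊗ S_πF` … `λ` belongs to `P_n` if and only if `IM_λ` belongs to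
> `T̂_{[det_n]}𝒟ual_{2n−2,n,n²}`" (§3.4) … "Proposition 3.4.2. `P_n = {1ⁿ, 21^{n−2}}`" … "so `T̂` must be
> equal to `𝔤𝔩(W)·det_n` … Theorem 3.1.1 immediately follows." (p. 480)

## State of the tree before this file

`LMR2013_thm_3_1_1` (a named fact) was reduced to EXACTLY the tangent inclusion
`T̂_{[det_n]}𝒟ual ⊆ 𝔤𝔩(W)·det_n` (`LMR2013_thm_3_1_1_iff_lmrZariskiTangent_subset`,
`LMR13ComponentFromTangent.lean`, val-lit-t11: the "irreducible component" clause from the tangent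
inclusion by dimension theory; `⊇` in `LMR13ZariskiTangentProofs.lean`); Prop. 3.4.2 is DISCHARGED
(`LMR2013_prop_3_4_2_holds`, `LMR13ImmanantFourTermRelations.lean`, val-lit-p7/p8/t10/t17: the (Zar)
ladder); `IM_{1ⁿ} = det_n` and `IM_{21^{n−2}} ∈ 𝔤𝔩(W)·det_n` (`LMR13ImmanantsTangent.lean`, val-lit-t11);
`T̂_{[P]}𝒟ual` is stable under every substitution `M` with `P ∘ M = c·P`, `c ≠ 0`
(`linSubst_mem_lmrZariskiTangent_of_linSubst_eq_smul`, `LMR13DualSchemeEquivariance.lean`, val-lit-t11).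
What was missing is the ISOTYPIC STEP "Prop. 3.4.2 ⇒ `T̂ ⊆ 𝔤𝔩(W)·det_n`", printed via the
multiplicity-free decomposition `Sⁿ(E ⊗ F) = ⊕ S_πE ⊗ S_πF` (Cauchy formula / Schur–Weyl duality,
not in Mathlib).

## What is proved here, and how (OUR route, avoiding the decomposition of `Sⁿ(E ⊗ F)`)

* §1 `lieDer N` — the derivation `D_N = Σ N_{ac} x_a ∂_c` (`= glTangentMap · N`), `[D_M, D_N] =
  D_{MN−NM}` (`lie_lieDer`), and `D_N (𝔤𝔩(W)·P) ⊆ 𝔤𝔩(W)·P` whenever `D_N P = c·P`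
  (`lieDer_mem_glTangent_of_lieDer_eq_smul`).
* §2 the row/column operators `D_{E_{ij} ⊗ 1} = Σ_c x_{ic} ∂_{jc}`, `D_{1 ⊗ E_{ij}}`; they act on
  `det_n` by `δ_{ij}` (`glTangentMap_detPoly_kronecker`, val-lit-t12 g3) and preserve `𝔤𝔩(W)·det_n`.
* §3 the `ℤ^n × ℤ^n`-grading of `ℂ[M_n]` by row/column contents (`rcWeight`, Mathlib's weighted
  homogeneity): Euler identities, weight shifts of the row/column operators, the pigeonhole
  "`α ≠ (1,…,1)`, `Σα = n` ⇒ some `α_i ≥ 2`, some `α_j = 0`".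
* §4 a subspace stable under the diagonal operators contains the weight components of its elements
  (`mem_of_sum_mem_of_separating_ops`, Lagrange extraction).
* §5 **Lie from group** (`lieDer_mem_of_linSubst_mem`): stability under `1 + tN` for infinitely many `t`
  ⇒ stability under `D_N` (Taylor coefficient in `ℂ[W][t]`, a separating linear form,
  `Polynomial.eq_zero_of_infinite_isRoot`).
* §6 permutations of rows/columns (`rename`) on `det_n`, on `𝔤𝔩(W)·P`, on `T̂_{[P]}𝒟ual`; the
  transport `permPoly : ℂ[𝔖_n] → span{x^{μ_ρ}}` with `Φ(g·a) = (g × 1)·Φ(a)`,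
  `Φ(a·g⁻¹) = (1 × g)·Φ(a)`, `Φ(e_{χ_λ}) = (χ_λ(1)/n!)·IM_λ`, and "weight `(1ⁿ;1ⁿ)` ⇒ in the image of `Φ`".
* §7 **the weight reduction** (`le_of_rowCol_stable_of_weightOne`): for `V, T ⊆ ℂ[E ⊗ F]` stable
  under all row/column operators, `V ⊆ T` as soon as the `(1ⁿ;1ⁿ)`-weight vectors of `V` lie in `T`
  — for a weight vector `u` with `α_i ≥ 2`, `α_j = 0`: `E_{i←j}u = 0` and
  `[E_{i←j}, E_{j←i}]u = (α_i − α_j)u`, so `E_{j←i}u ∈ T ⇒ u ∈ T`; induction on `Σα² + Σβ²`.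
  (This one-line `𝔰𝔩₂` computation replaces the decomposition into `S_πE ⊗ S_πF`.)
* §8 for `det_n` (`n ≥ 3`): `(a ⊗ b)·det_n = det a det b · det_n` (`linSubst_kronecker_detPoly`), so
  `T̂` is stable under the row/column one-parameter groups, hence (§5) under the row/column operators;
  its `(1ⁿ;1ⁿ)`-part pulls back to a two-sided ideal of `ℂ[𝔖_n]`, which lies in the pull-back of
  `𝔤𝔩(W)·det_n` because it is generated by the `e_{χ_λ}` it contains
  (`le_of_forall_charIdempotent_mem`, `Literature/RepresentationTheory/FiniteGroups/GroupAlgebraTwoSidedIdeals.lean`)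
  and `IM_λ ∈ T̂ ⇒ λ ∈ {1ⁿ, 21^{n−2}} ⇒ IM_λ ∈ 𝔤𝔩(W)·det_n` (Prop. 3.4.2):
  **`lmrZariskiTangent_detPoly_subset_glTangent`** and **`LMR2013_thm_3_1_1_holds`**.

Definitions (plumbing, with bodies): `lieDer`, `rcWeight`, `permPoly` (+ private `curvePoly`,
`wtMeasure`). No named facts. Honest framing: this discharges a typed 2013 theorem about the dual
scheme of `det_n`; **VP ≠ VNP is NOT proved and nothing here is progress on it.**

## References

* [LandsbergManivelRessayre2013] J. M. Landsberg, L. Manivel, N. Ressayre, *Hypersurfaces with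
  degenerate duals and the Geometric Complexity Theory Program*, Comment. Math. Helv. 88 (2013)
  469–484, Thm. 3.1.1 (p. 476), §3.3–§3.4 and Prop. 3.4.2 (pp. 477–480); arXiv:1004.4802.
* [Isaacs1976] I. M. Isaacs, *Character Theory of Finite Groups*, Thm. 1.15, Thm. 2.12 (two-sided
  ideals of `ℂ[G]` and the idempotents `e_χ`).
* [FultonHarrisGTM129] W. Fulton, J. Harris, *Representation Theory*, §4.1 (characters of `𝔖_n`).
-/

noncomputable section

open MvPolynomial Matrix Literature.NumberTheory.DiophantineGeometry Literature.RepresentationTheory.FiniteGroups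
open scoped Kronecker BigOperators

namespace Literature.Computability.AlgebraicComplexity

/-! ### §1 The derivations `D_N = Σ_{a,c} N_{ac} x_a ∂_c` of `𝔤𝔩(W)` on `ℂ[W]` -/

section LieDer

variable {σ : Type*} [Fintype σ] [DecidableEq σ]

/-- **The derivation `D_N` of `ℂ[x_σ]` attached to `N ∈ 𝔤𝔩(W)`**: `x_c ↦ Σ_a N_{ac} x_a`, i.e.
`D_N P = Σ_{a,c} N_{ac} x_a ∂_c P = N · P` (`glTangentMap P N`, the infinitesimal form of the
substitution `x_c ↦ Σ_a M_{ac} x_a` of `linSubst`; LMR §3.4 "the tangent space `𝔤𝔩(W)·P`").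
[cite: LandsbergManivelRessayre2013, §3.4 (p. 479)] -/
def lieDer (N : Matrix σ σ ℂ) : Derivation ℂ (MvPolynomial σ ℂ) (MvPolynomial σ ℂ) :=
  MvPolynomial.mkDerivation ℂ fun c => ∑ a, N a c • (X a : MvPolynomial σ ℂ)

omit [DecidableEq σ] in
/-- `D_N x_c = Σ_a N_{ac} x_a`. [cite: LandsbergManivelRessayre2013, §3.4 (p. 479)] -/
theorem lieDer_X (N : Matrix σ σ ℂ) (c : σ) :
    lieDer N (X c) = ∑ a, N a c • (X a : MvPolynomial σ ℂ) :=
  MvPolynomial.mkDerivation_X _ _ _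

/-- A derivation of `ℂ[x_σ]` (`σ` finite) is determined by its values on the variables:
`D P = Σ_b ∂_b P · D(x_b)` (chain rule). [folklore] -/
private theorem derivation_apply_eq_sum_pderiv_mul
    (D : Derivation ℂ (MvPolynomial σ ℂ) (MvPolynomial σ ℂ)) (P : MvPolynomial σ ℂ) :
    D P = ∑ b, pderiv b P * D (X b) := by
  induction P using MvPolynomial.induction_on with
  | C a => simp [MvPolynomial.derivation_C]
  | add p q hp hq => simp only [map_add, hp, hq, add_mul, Finset.sum_add_distrib]
  | mul_X p i hp =>
    rw [Derivation.leibniz, hp, smul_eq_mul, smul_eq_mul, Finset.mul_sum]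
    simp only [Derivation.leibniz, pderiv_X, smul_eq_mul, add_mul, Finset.sum_add_distrib]
    congr 1
    · rw [Finset.sum_eq_single i]
      · simp [Pi.single_eq_same]
      · intro b _ hb; simp [Pi.single_eq_of_ne (Ne.symm hb)]
      · intro h; exact absurd (Finset.mem_univ i) h
    · exact Finset.sum_congr rfl fun b _ => by ring

/-- **`D_N P = N · P`** (`glTangentMap P N = Σ_{a,c} N_{ac} x_a ∂_c P`): the derivation `lieDer N` is
the tangent action of `𝔤𝔩(W)` of `GLAnnihilator.lean`. [cite: LandsbergManivelRessayre2013, §3.4 (p. 479)] -/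
theorem lieDer_apply (N : Matrix σ σ ℂ) (P : MvPolynomial σ ℂ) :
    lieDer N P = glTangentMap P N := by
  rw [derivation_apply_eq_sum_pderiv_mul, glTangentMap_eq_sum_mul_pderiv]
  exact Finset.sum_congr rfl fun b _ => by rw [lieDer_X, mul_comm]

/-- `D_N P = Σ_{a,c} N_{ac} · (x_a ∂_c P)`. [cite: LandsbergManivelRessayre2013, §3.4 (p. 479)] -/
theorem lieDer_apply_eq_sum (N : Matrix σ σ ℂ) (P : MvPolynomial σ ℂ) :
    lieDer N P = ∑ a, ∑ c, N a c • (X a * pderiv c P) := by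
  rw [lieDer_apply, glTangentMap_apply]

omit [DecidableEq σ] in
/-- `N ↦ D_N` is additive. [cite: LandsbergManivelRessayre2013, §3.4 (p. 479)] -/
theorem lieDer_add (M N : Matrix σ σ ℂ) : lieDer (M + N) = lieDer M + lieDer N := by
  refine MvPolynomial.derivation_ext fun c => ?_
  simp only [Derivation.add_apply, lieDer_X, Matrix.add_apply, add_smul, Finset.sum_add_distrib]

omit [DecidableEq σ] in
/-- `N ↦ D_N` is compatible with subtraction. [cite: LandsbergManivelRessayre2013, §3.4 (p. 479)] -/
theorem lieDer_sub (M N : Matrix σ σ ℂ) : lieDer (M - N) = lieDer M - lieDer N := by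
  refine MvPolynomial.derivation_ext fun c => ?_
  simp only [Derivation.sub_apply, lieDer_X, Matrix.sub_apply, sub_smul, Finset.sum_sub_distrib]

omit [DecidableEq σ] in
/-- `N ↦ D_N` is homogeneous. [cite: LandsbergManivelRessayre2013, §3.4 (p. 479)] -/
theorem lieDer_smul (t : ℂ) (N : Matrix σ σ ℂ) : lieDer (t • N) = t • lieDer N := by
  refine MvPolynomial.derivation_ext fun c => ?_
  simp only [Derivation.smul_apply, lieDer_X, Matrix.smul_apply, smul_eq_mul, mul_smul,
    Finset.smul_sum]

omit [DecidableEq σ] in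
/-- **`[D_M, D_N] = D_{MN − NM}`**: `N ↦ D_N` is a Lie algebra homomorphism `𝔤𝔩(W) → Der ℂ[W]`
(the infinitesimal form of `(AB)·P = A·(B·P)`, `linSubst_mul`).
[cite: LandsbergManivelRessayre2013, §3.4 (p. 479)] -/
theorem lie_lieDer (M N : Matrix σ σ ℂ) : ⁅lieDer M, lieDer N⁆ = lieDer (M * N - N * M) := by
  refine MvPolynomial.derivation_ext fun c => ?_
  have hMN : ∀ (M N : Matrix σ σ ℂ), lieDer M (lieDer N (X c)) =
      ∑ b, (∑ a, M b a * N a c) • (X b : MvPolynomial σ ℂ) := fun M N => by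
    rw [lieDer_X, map_sum]
    simp only [Derivation.map_smul, lieDer_X, Finset.smul_sum, smul_smul, Finset.sum_smul]
    rw [Finset.sum_comm]
    exact Finset.sum_congr rfl fun b _ => Finset.sum_congr rfl fun a _ => by rw [mul_comm]
  rw [Derivation.commutator_apply, hMN, hMN, lieDer_X, ← Finset.sum_sub_distrib]
  exact Finset.sum_congr rfl fun b _ => by rw [Matrix.sub_apply, Matrix.mul_apply, Matrix.mul_apply,
    sub_smul]

omit [DecidableEq σ] in
/-- Pointwise commutator: `D_M (D_N P) − D_N (D_M P) = D_{MN−NM} P`.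
[cite: LandsbergManivelRessayre2013, §3.4 (p. 479)] -/
theorem lieDer_lieDer_sub (M N : Matrix σ σ ℂ) (P : MvPolynomial σ ℂ) :
    lieDer M (lieDer N P) - lieDer N (lieDer M P) = lieDer (M * N - N * M) P := by
  rw [← Derivation.commutator_apply, lie_lieDer]

/-- **The orbit tangent space `𝔤𝔩(W)·P` is stable under every `D_N` with `D_N P = c·P`** (i.e. `N`
in the Lie algebra of the stabiliser of `[P]`): `D_N (Z·P) = Z·(D_N P) + [N,Z]·P = c Z·P + (NZ−ZN)·P`.
For `P = det_n` and `N ∈ 𝔤𝔩(E) ⊕ 𝔤𝔩(F)` this is the `GL(E)×GL(F)`-module structure of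
`𝔤𝔩(W)·det_n` (§3.4). [cite: LandsbergManivelRessayre2013, §3.4 (p. 479)] -/
theorem lieDer_mem_glTangent_of_lieDer_eq_smul {P : MvPolynomial σ ℂ} {N : Matrix σ σ ℂ} {c : ℂ}
    (hN : lieDer N P = c • P) {p : MvPolynomial σ ℂ} (hp : p ∈ glTangent P) :
    lieDer N p ∈ glTangent P := by
  rw [← range_glTangentMap] at hp ⊢
  obtain ⟨Z, rfl⟩ := hp
  have h := lieDer_lieDer_sub N Z P
  rw [sub_eq_iff_eq_add] at h
  rw [← lieDer_apply, h, hN, Derivation.map_smul, lieDer_apply, lieDer_apply]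
  exact add_mem (LinearMap.mem_range_self _ _) (Submodule.smul_mem _ _ (LinearMap.mem_range_self _ _))

/-- `D_N` preserves forms of each degree. [cite: LandsbergManivelRessayre2013, §3.4 (p. 479)] -/
theorem isHomogeneous_lieDer (N : Matrix σ σ ℂ) {P : MvPolynomial σ ℂ} {n : ℕ}
    (hP : P.IsHomogeneous n) : (lieDer N P).IsHomogeneous n := by
  rw [lieDer_apply_eq_sum]
  refine IsHomogeneous.sum _ _ _ fun a _ => IsHomogeneous.sum _ _ _ fun c _ => ?_
  rcases Nat.eq_zero_or_pos n with rfl | hn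
  · have hP0 : pderiv c P = 0 := by
      rw [← totalDegree_zero_iff_isHomogeneous, totalDegree_eq_zero_iff_eq_C] at hP
      rw [hP, pderiv_C]
    rw [hP0, mul_zero, smul_zero]
    exact isHomogeneous_zero _ _ _
  · have h := (isHomogeneous_X ℂ a).mul (hP.pderiv (i := c))
    rw [show 1 + (n - 1) = n by omega] at h
    rw [smul_eq_C_mul]
    exact h.C_mul _

end LieDer

/-! ### §2 Row and column operators on `ℂ[M_n]`: `E^{row}_{ij} = D_{E_{ij} ⊗ 1}`, `E^{col}_{ij} = D_{1 ⊗ E_{ij}}` -/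

section RowCol

variable {ι : Type*} [Fintype ι] [DecidableEq ι]

/-- **`D_{E_{ij} ⊗ 1} = Σ_c x_{ic} ∂_{jc}`**: the row operator replacing a variable of row `j` by the
variable of row `i` in the same column (the action of `𝔤𝔩(E)` on `ℂ[E ⊗ F]`).
[cite: LandsbergManivelRessayre2013, §3.4 (p. 479)] -/
theorem lieDer_single_kronecker_one (i j : ι) (P : MvPolynomial (ι × ι) ℂ) :
    lieDer (Matrix.single i j (1 : ℂ) ⊗ₖ (1 : Matrix ι ι ℂ)) P =
      ∑ c, X (i, c) * pderiv (j, c) P := by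
  rw [lieDer_apply_eq_sum, Fintype.sum_prod_type]
  rw [Finset.sum_eq_single i]
  · refine Finset.sum_congr rfl fun c _ => ?_
    rw [Fintype.sum_prod_type, Finset.sum_eq_single j]
    · rw [Finset.sum_eq_single c]
      · simp [Matrix.kroneckerMap_apply]
      · intro c' _ hc'
        simp [Matrix.kroneckerMap_apply, Matrix.one_apply_ne (Ne.symm hc')]
      · intro h; exact absurd (Finset.mem_univ c) h
    · intro j' _ hj'
      exact Finset.sum_eq_zero fun c' _ => by
        simp [Matrix.kroneckerMap_apply, Ne.symm hj']
    · intro h; exact absurd (Finset.mem_univ j) h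
  · intro i' _ hi'
    exact Finset.sum_eq_zero fun c _ => Finset.sum_eq_zero fun b _ => by
      obtain ⟨j', c'⟩ := b
      simp [Matrix.kroneckerMap_apply, Ne.symm hi']
  · intro h; exact absurd (Finset.mem_univ i) h

/-- **`D_{1 ⊗ E_{ij}} = Σ_r x_{ri} ∂_{rj}`**: the column operator (the action of `𝔤𝔩(F)`).
[cite: LandsbergManivelRessayre2013, §3.4 (p. 479)] -/
theorem lieDer_one_kronecker_single (i j : ι) (P : MvPolynomial (ι × ι) ℂ) :
    lieDer ((1 : Matrix ι ι ℂ) ⊗ₖ Matrix.single i j (1 : ℂ)) P =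
      ∑ r, X (r, i) * pderiv (r, j) P := by
  rw [lieDer_apply_eq_sum, Fintype.sum_prod_type]
  refine Finset.sum_congr rfl fun r _ => ?_
  rw [Finset.sum_eq_single i]
  · rw [Fintype.sum_prod_type, Finset.sum_eq_single r]
    · rw [Finset.sum_eq_single j]
      · simp [Matrix.kroneckerMap_apply]
      · intro j' _ hj'
        simp [Matrix.kroneckerMap_apply, Ne.symm hj']
      · intro h; exact absurd (Finset.mem_univ j) h
    · intro r' _ hr'
      exact Finset.sum_eq_zero fun c' _ => by
        simp [Matrix.kroneckerMap_apply, Matrix.one_apply_ne (Ne.symm hr')]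
    · intro h; exact absurd (Finset.mem_univ r) h
  · intro i' _ hi'
    exact Finset.sum_eq_zero fun b _ => by
      obtain ⟨r', c'⟩ := b
      simp [Matrix.kroneckerMap_apply, Ne.symm hi']
  · intro h; exact absurd (Finset.mem_univ i) h

/-- `(E_{ij} ⊗ 1)(E_{kl} ⊗ 1) − (E_{kl} ⊗ 1)(E_{ij} ⊗ 1)` for `(k,l) = (j,i)`:
`[E_{ij} ⊗ 1, E_{ji} ⊗ 1] = (E_{ii} − E_{jj}) ⊗ 1`. [folklore] -/
private theorem single_kronecker_comm (i j : ι) :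
    Matrix.single i j (1 : ℂ) ⊗ₖ (1 : Matrix ι ι ℂ) * (Matrix.single j i (1 : ℂ) ⊗ₖ (1 : Matrix ι ι ℂ)) -
      Matrix.single j i (1 : ℂ) ⊗ₖ (1 : Matrix ι ι ℂ) * (Matrix.single i j (1 : ℂ) ⊗ₖ (1 : Matrix ι ι ℂ)) =
      Matrix.single i i (1 : ℂ) ⊗ₖ (1 : Matrix ι ι ℂ) - Matrix.single j j (1 : ℂ) ⊗ₖ (1 : Matrix ι ι ℂ) := by
  rw [← Matrix.mul_kronecker_mul, ← Matrix.mul_kronecker_mul, Matrix.single_mul_single_same,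
    Matrix.single_mul_single_same, Matrix.mul_one, mul_one]

/-- Column version: `[1 ⊗ E_{ij}, 1 ⊗ E_{ji}] = 1 ⊗ (E_{ii} − E_{jj})`. [folklore] -/
private theorem one_kronecker_single_comm (i j : ι) :
    (1 : Matrix ι ι ℂ) ⊗ₖ Matrix.single i j (1 : ℂ) * ((1 : Matrix ι ι ℂ) ⊗ₖ Matrix.single j i (1 : ℂ)) -
      (1 : Matrix ι ι ℂ) ⊗ₖ Matrix.single j i (1 : ℂ) * ((1 : Matrix ι ι ℂ) ⊗ₖ Matrix.single i j (1 : ℂ)) =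
      (1 : Matrix ι ι ℂ) ⊗ₖ Matrix.single i i (1 : ℂ) - (1 : Matrix ι ι ℂ) ⊗ₖ Matrix.single j j (1 : ℂ) := by
  rw [← Matrix.mul_kronecker_mul, ← Matrix.mul_kronecker_mul, Matrix.single_mul_single_same,
    Matrix.single_mul_single_same, Matrix.mul_one, mul_one]

/-- **`D_{E_{ij} ⊗ 1} det_n = δ_{ij} det_n`** (`(A ⊗ 1 + 1 ⊗ B)·det_n = (tr A + tr B) det_n`,
`glTangentMap_detPoly_kronecker`): `𝔤𝔩(E) ⊕ 𝔤𝔩(F)` stabilises the line of `det_n`.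
[cite: LandsbergManivelRessayre2013, §3.4 (p. 479)] -/
theorem lieDer_single_kronecker_one_detPoly (i j : ι) :
    lieDer (Matrix.single i j (1 : ℂ) ⊗ₖ (1 : Matrix ι ι ℂ)) (detPoly ι ℂ) =
      (if i = j then (1 : ℂ) else 0) • detPoly ι ℂ := by
  have h := glTangentMap_detPoly_kronecker (ι := ι) (Matrix.single j i (1 : ℂ)) 0
  rw [Matrix.kronecker_zero, add_zero, Matrix.transpose_single, Matrix.trace_zero, add_zero] at h
  rw [lieDer_apply, h]
  by_cases hij : i = j
  · subst hij; rw [Matrix.trace_single_eq_same, if_pos rfl]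
  · rw [Matrix.trace_single_eq_of_ne _ _ _ (Ne.symm hij), if_neg hij]

/-- **`D_{1 ⊗ E_{ij}} det_n = δ_{ij} det_n`** (column version). [cite: LandsbergManivelRessayre2013, §3.4 (p. 479)] -/
theorem lieDer_one_kronecker_single_detPoly (i j : ι) :
    lieDer ((1 : Matrix ι ι ℂ) ⊗ₖ Matrix.single i j (1 : ℂ)) (detPoly ι ℂ) =
      (if i = j then (1 : ℂ) else 0) • detPoly ι ℂ := by
  have h := glTangentMap_detPoly_kronecker (ι := ι) 0 (Matrix.single i j (1 : ℂ))
  rw [Matrix.transpose_zero, Matrix.zero_kronecker, zero_add, Matrix.trace_zero, zero_add] at h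
  rw [lieDer_apply, h]
  by_cases hij : i = j
  · subst hij; rw [Matrix.trace_single_eq_same, if_pos rfl]
  · rw [Matrix.trace_single_eq_of_ne _ _ _ hij, if_neg hij]

/-- **`𝔤𝔩(W)·det_n` is stable under the row operators `D_{E_{ij} ⊗ 1}`** (it is a
`GL(E)×GL(F)`-submodule, §3.4). [cite: LandsbergManivelRessayre2013, §3.4 (p. 479)] -/
theorem lieDer_single_kronecker_one_mem_glTangent_detPoly (i j : ι) {p : MvPolynomial (ι × ι) ℂ}
    (hp : p ∈ glTangent (detPoly ι ℂ)) :
    lieDer (Matrix.single i j (1 : ℂ) ⊗ₖ (1 : Matrix ι ι ℂ)) p ∈ glTangent (detPoly ι ℂ) :=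
  lieDer_mem_glTangent_of_lieDer_eq_smul (lieDer_single_kronecker_one_detPoly i j) hp

/-- **`𝔤𝔩(W)·det_n` is stable under the column operators `D_{1 ⊗ E_{ij}}`**.
[cite: LandsbergManivelRessayre2013, §3.4 (p. 479)] -/
theorem lieDer_one_kronecker_single_mem_glTangent_detPoly (i j : ι) {p : MvPolynomial (ι × ι) ℂ}
    (hp : p ∈ glTangent (detPoly ι ℂ)) :
    lieDer ((1 : Matrix ι ι ℂ) ⊗ₖ Matrix.single i j (1 : ℂ)) p ∈ glTangent (detPoly ι ℂ) :=
  lieDer_mem_glTangent_of_lieDer_eq_smul (lieDer_one_kronecker_single_detPoly i j) hp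

end RowCol

/-! ### §3 Row/column contents as a `ℤ^ι × ℤ^ι`-grading of `ℂ[M_n]` (torus weights) -/

section Weights

variable (ι : Type*) [Fintype ι] [DecidableEq ι]

/-- **The torus weight of the variable `x_{rc}`**: `(e_r, e_c) ∈ ℤ^ι × ℤ^ι` (row and column). A
monomial `x^d` has weight `(row contents of d, column contents of d)`; the maximal torus
`T(E) × T(F) ⊂ GL(E) × GL(F)` acts on the weight-`(α,β)` part of `ℂ[E ⊗ F]` by the character
`(s,t) ↦ s^α t^β`. [cite: LandsbergManivelRessayre2013, §3.4 (p. 479)] -/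
def rcWeight : ι × ι → (ι → ℤ) × (ι → ℤ) := fun p => (Pi.single p.1 1, Pi.single p.2 1)

variable {ι}

/-- The weight of an exponent vector `d` is `(rowCount d, colCount d)`.
[cite: LandsbergManivelRessayre2013, §3.4 (p. 479)] -/
theorem weight_rcWeight (d : ι × ι →₀ ℕ) :
    Finsupp.weight (rcWeight ι) d = (fun r => (rowCount d r : ℤ), fun c => (colCount d c : ℤ)) := by
  rw [Finsupp.weight_apply, Finsupp.sum_fintype _ _ (fun p => by simp)]
  refine Prod.ext (funext fun r => ?_) (funext fun c => ?_)
  · simp only [Prod.fst_sum, Finset.sum_apply, Prod.smul_fst, rcWeight, Pi.smul_apply, Pi.single_apply]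
    unfold rowCount
    rw [Nat.cast_sum, Fintype.sum_prod_type, Finset.sum_eq_single r]
    · exact Finset.sum_congr rfl fun c' _ => by simp
    · intro r' _ hr'
      exact Finset.sum_eq_zero fun c' _ => by simp [Ne.symm hr']
    · intro h; exact absurd (Finset.mem_univ r) h
  · simp only [Prod.snd_sum, Finset.sum_apply, Prod.smul_snd, rcWeight, Pi.smul_apply, Pi.single_apply]
    unfold colCount
    rw [Nat.cast_sum, Fintype.sum_prod_type, Finset.sum_comm, Finset.sum_eq_single c]
    · exact Finset.sum_congr rfl fun r' _ => by simp
    · intro c' _ hc'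
      exact Finset.sum_eq_zero fun r' _ => by simp [Ne.symm hc']
    · intro h; exact absurd (Finset.mem_univ c) h

/-- The row content of a weight-`m` form is read off any of its monomials.
[cite: LandsbergManivelRessayre2013, §3.4 (p. 479)] -/
theorem fst_eq_rowCount_of_isWeightedHomogeneous {φ : MvPolynomial (ι × ι) ℂ} {m : (ι → ℤ) × (ι → ℤ)}
    (hφ : IsWeightedHomogeneous (rcWeight ι) φ m) {d : ι × ι →₀ ℕ} (hd : coeff d φ ≠ 0) (r : ι) :
    m.1 r = rowCount d r := by
  rw [← hφ hd, weight_rcWeight]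

/-- The column content of a weight-`m` form is read off any of its monomials.
[cite: LandsbergManivelRessayre2013, §3.4 (p. 479)] -/
theorem snd_eq_colCount_of_isWeightedHomogeneous {φ : MvPolynomial (ι × ι) ℂ} {m : (ι → ℤ) × (ι → ℤ)}
    (hφ : IsWeightedHomogeneous (rcWeight ι) φ m) {d : ι × ι →₀ ℕ} (hd : coeff d φ ≠ 0) (c : ι) :
    m.2 c = colCount d c := by
  rw [← hφ hd, weight_rcWeight]

omit [Fintype ι] [DecidableEq ι] in
/-- `x_p ∂_p` acts on a monomial by its exponent at `p` (Euler, one variable). [folklore] -/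
private theorem X_mul_pderiv_monomial' (p : ι × ι) (s : ι × ι →₀ ℕ) (a : ℂ) :
    X p * pderiv p (monomial s a) = (s p : ℂ) • monomial s a := by
  classical
  rw [pderiv_monomial]
  by_cases hs : s p = 0
  · rw [hs, Nat.cast_zero, mul_zero, monomial_zero, mul_zero, zero_smul]
  · rw [X, monomial_mul, one_mul, MvPolynomial.smul_monomial]
    congr 1
    · rw [add_comm, tsub_add_cancel_of_le]
      exact Finsupp.single_le_iff.mpr (Nat.one_le_iff_ne_zero.mpr hs)
    · rw [smul_eq_mul, mul_comm]

/-- **Row Euler identity**: the row operator `D_{E_{ii} ⊗ 1} = Σ_c x_{ic} ∂_{ic}` acts on the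
weight-`m` part by the scalar `m.1 i` (the `i`-th row content). [cite: LandsbergManivelRessayre2013, §3.4 (p. 479)] -/
theorem sum_X_mul_pderiv_row_of_isWeightedHomogeneous {φ : MvPolynomial (ι × ι) ℂ}
    {m : (ι → ℤ) × (ι → ℤ)} (hφ : IsWeightedHomogeneous (rcWeight ι) φ m) (i : ι) :
    ∑ c, X (i, c) * pderiv (i, c) φ = (m.1 i : ℂ) • φ := by
  classical
  have key : ∀ d ∈ φ.support, ∑ c, X (i, c) * pderiv (i, c) (monomial d (coeff d φ)) =
      (m.1 i : ℂ) • monomial d (coeff d φ) := fun d hd => by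
    simp only [X_mul_pderiv_monomial']
    rw [← Finset.sum_smul, fst_eq_rowCount_of_isWeightedHomogeneous hφ (mem_support_iff.mp hd) i]
    unfold rowCount
    rw [Nat.cast_sum]
    norm_cast
  calc ∑ c, X (i, c) * pderiv (i, c) φ
      = ∑ c, ∑ d ∈ φ.support, X (i, c) * pderiv (i, c) (monomial d (coeff d φ)) := by
        refine Finset.sum_congr rfl fun c _ => ?_
        conv_lhs => rw [φ.as_sum]
        rw [map_sum, Finset.mul_sum]
    _ = ∑ d ∈ φ.support, ∑ c, X (i, c) * pderiv (i, c) (monomial d (coeff d φ)) := Finset.sum_comm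
    _ = ∑ d ∈ φ.support, (m.1 i : ℂ) • monomial d (coeff d φ) := Finset.sum_congr rfl key
    _ = (m.1 i : ℂ) • φ := by rw [← Finset.smul_sum, ← φ.as_sum]

/-- **Column Euler identity**: `Σ_r x_{rj} ∂_{rj}` acts on the weight-`m` part by `m.2 j`.
[cite: LandsbergManivelRessayre2013, §3.4 (p. 479)] -/
theorem sum_X_mul_pderiv_col_of_isWeightedHomogeneous {φ : MvPolynomial (ι × ι) ℂ}
    {m : (ι → ℤ) × (ι → ℤ)} (hφ : IsWeightedHomogeneous (rcWeight ι) φ m) (j : ι) :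
    ∑ r, X (r, j) * pderiv (r, j) φ = (m.2 j : ℂ) • φ := by
  classical
  have key : ∀ d ∈ φ.support, ∑ r, X (r, j) * pderiv (r, j) (monomial d (coeff d φ)) =
      (m.2 j : ℂ) • monomial d (coeff d φ) := fun d hd => by
    simp only [X_mul_pderiv_monomial']
    rw [← Finset.sum_smul, snd_eq_colCount_of_isWeightedHomogeneous hφ (mem_support_iff.mp hd) j]
    unfold colCount
    rw [Nat.cast_sum]
    norm_cast
  calc ∑ r, X (r, j) * pderiv (r, j) φ
      = ∑ r, ∑ d ∈ φ.support, X (r, j) * pderiv (r, j) (monomial d (coeff d φ)) := by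
        refine Finset.sum_congr rfl fun r _ => ?_
        conv_lhs => rw [φ.as_sum]
        rw [map_sum, Finset.mul_sum]
    _ = ∑ d ∈ φ.support, ∑ r, X (r, j) * pderiv (r, j) (monomial d (coeff d φ)) := Finset.sum_comm
    _ = ∑ d ∈ φ.support, (m.2 j : ℂ) • monomial d (coeff d φ) := Finset.sum_congr rfl key
    _ = (m.2 j : ℂ) • φ := by rw [← Finset.smul_sum, ← φ.as_sum]

/-- `∂_k` lowers the weight by `w k` (weights valued in a group).
[cite: LandsbergManivelRessayre2013, §3.4 (p. 479)] -/
theorem isWeightedHomogeneous_pderiv {σ M : Type*} [AddCommGroup M] {w : σ → M}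
    {φ : MvPolynomial σ ℂ} {m : M} (hφ : IsWeightedHomogeneous w φ m) (k : σ) :
    IsWeightedHomogeneous w (pderiv k φ) (m - w k) := by
  classical
  rw [φ.as_sum, map_sum]
  refine IsWeightedHomogeneous.sum _ _ _ fun d hd => ?_
  rw [pderiv_monomial]
  by_cases hk : d k = 0
  · rw [hk, Nat.cast_zero, mul_zero, monomial_zero]
    exact isWeightedHomogeneous_zero ℂ w _
  · refine isWeightedHomogeneous_monomial w _ _ ?_
    have hd' : Finsupp.weight w d = m := hφ (mem_support_iff.mp hd)
    have hsplit : d - Finsupp.single k 1 + Finsupp.single k 1 = d := by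
      ext q
      simp only [Finsupp.add_apply, Finsupp.tsub_apply, Finsupp.single_apply]
      split_ifs with h
      · subst h; omega
      · omega
    have := congrArg (Finsupp.weight w) hsplit
    rw [map_add, hd'] at this
    have hwk : Finsupp.weight w (Finsupp.single k 1) = w k := by
      rw [Finsupp.weight_apply, Finsupp.sum_single_index (zero_smul ℕ (w k)), one_smul]
    rw [hwk] at this
    exact eq_sub_of_add_eq this

/-- The row operator `Σ_c x_{jc} ∂_{ic}` (`D_{E_{ji} ⊗ 1}`) shifts the weight by `(e_j − e_i, 0)`:
it moves one unit of row content from row `i` to row `j`. [cite: LandsbergManivelRessayre2013, §3.4 (p. 479)] -/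
theorem isWeightedHomogeneous_rowOp {φ : MvPolynomial (ι × ι) ℂ} {m : (ι → ℤ) × (ι → ℤ)}
    (hφ : IsWeightedHomogeneous (rcWeight ι) φ m) (i j : ι) :
    IsWeightedHomogeneous (rcWeight ι) (∑ c, X (j, c) * pderiv (i, c) φ)
      (m + (Pi.single j 1 - Pi.single i 1, 0)) := by
  refine IsWeightedHomogeneous.sum _ _ _ fun c _ => ?_
  have h := (isWeightedHomogeneous_X ℂ (rcWeight ι) (j, c)).mul (isWeightedHomogeneous_pderiv hφ (i, c))
  convert h using 1
  simp only [rcWeight, Prod.ext_iff, Prod.fst_add, Prod.snd_add, Prod.fst_sub, Prod.snd_sub]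
  constructor <;> (funext r; simp only [Pi.add_apply, Pi.sub_apply, Pi.zero_apply]; ring)

/-- The column operator `Σ_r x_{rj} ∂_{ri}` (`D_{1 ⊗ E_{ji}}`) shifts the weight by `(0, e_j − e_i)`.
[cite: LandsbergManivelRessayre2013, §3.4 (p. 479)] -/
theorem isWeightedHomogeneous_colOp {φ : MvPolynomial (ι × ι) ℂ} {m : (ι → ℤ) × (ι → ℤ)}
    (hφ : IsWeightedHomogeneous (rcWeight ι) φ m) (i j : ι) :
    IsWeightedHomogeneous (rcWeight ι) (∑ r, X (r, j) * pderiv (r, i) φ)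
      (m + (0, Pi.single j 1 - Pi.single i 1)) := by
  refine IsWeightedHomogeneous.sum _ _ _ fun r _ => ?_
  have h := (isWeightedHomogeneous_X ℂ (rcWeight ι) (r, j)).mul (isWeightedHomogeneous_pderiv hφ (r, i))
  convert h using 1
  simp only [rcWeight, Prod.ext_iff, Prod.fst_add, Prod.snd_add, Prod.fst_sub, Prod.snd_sub]
  constructor <;> (funext r; simp only [Pi.add_apply, Pi.sub_apply, Pi.zero_apply]; ring)

/-- A form with no variable from row `j` (`m.1 j = 0`) is killed by every `∂_{jc}`, hence by the
row operators `Σ_c x_{ic} ∂_{jc}`. [cite: LandsbergManivelRessayre2013, §3.4 (p. 479)] -/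
theorem sum_X_mul_pderiv_eq_zero_of_row_eq_zero {φ : MvPolynomial (ι × ι) ℂ} {m : (ι → ℤ) × (ι → ℤ)}
    (hφ : IsWeightedHomogeneous (rcWeight ι) φ m) {j : ι} (hj : m.1 j = 0) (i : ι) :
    ∑ c, X (i, c) * pderiv (j, c) φ = 0 := by
  classical
  refine Finset.sum_eq_zero fun c _ => ?_
  suffices h : pderiv (j, c) φ = 0 by rw [h, mul_zero]
  rw [φ.as_sum, map_sum]
  refine Finset.sum_eq_zero fun d hd => ?_
  have hrow := fst_eq_rowCount_of_isWeightedHomogeneous hφ (mem_support_iff.mp hd) j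
  rw [hj] at hrow
  have hdj : d (j, c) = 0 := by
    have : rowCount d j = 0 := by exact_mod_cast hrow.symm
    exact Finset.sum_eq_zero_iff.mp this c (Finset.mem_univ c)
  rw [pderiv_monomial, hdj, Nat.cast_zero, mul_zero, monomial_zero]

/-- Column version: a form with no variable from column `j` is killed by `Σ_r x_{ri} ∂_{rj}`.
[cite: LandsbergManivelRessayre2013, §3.4 (p. 479)] -/
theorem sum_X_mul_pderiv_eq_zero_of_col_eq_zero {φ : MvPolynomial (ι × ι) ℂ} {m : (ι → ℤ) × (ι → ℤ)}
    (hφ : IsWeightedHomogeneous (rcWeight ι) φ m) {j : ι} (hj : m.2 j = 0) (i : ι) :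
    ∑ r, X (r, i) * pderiv (r, j) φ = 0 := by
  classical
  refine Finset.sum_eq_zero fun r _ => ?_
  suffices h : pderiv (r, j) φ = 0 by rw [h, mul_zero]
  rw [φ.as_sum, map_sum]
  refine Finset.sum_eq_zero fun d hd => ?_
  have hcol := snd_eq_colCount_of_isWeightedHomogeneous hφ (mem_support_iff.mp hd) j
  rw [hj] at hcol
  have hdj : d (r, j) = 0 := by
    have : colCount d j = 0 := by exact_mod_cast hcol.symm
    exact Finset.sum_eq_zero_iff.mp this r (Finset.mem_univ r)
  rw [pderiv_monomial, hdj, Nat.cast_zero, mul_zero, monomial_zero]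

/-- The weight components of a form of degree `n` are forms of degree `n`. [folklore] -/
private theorem isHomogeneous_weightedHomogeneousComponent {σ M : Type*} [AddCommMonoid M]
    (w : σ → M) {φ : MvPolynomial σ ℂ} {n : ℕ} (hφ : φ.IsHomogeneous n) (m : M) :
    (weightedHomogeneousComponent w m φ).IsHomogeneous n := by
  classical
  intro d hd
  rw [coeff_weightedHomogeneousComponent] at hd
  split_ifs at hd with h
  · exact hφ hd
  · exact absurd rfl hd

/-- For a non-zero form of degree `n = |ι|` and weight `m`: the row contents are `≥ 0` and sum
to `n`. [cite: LandsbergManivelRessayre2013, §3.4 (p. 479)] -/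
theorem rowContent_nonneg_sum_eq {φ : MvPolynomial (ι × ι) ℂ} {m : (ι → ℤ) × (ι → ℤ)} {n : ℕ}
    (hφ : IsWeightedHomogeneous (rcWeight ι) φ m) (hφn : φ.IsHomogeneous n) (hφ0 : φ ≠ 0) :
    (∀ i, 0 ≤ m.1 i) ∧ ∑ i, m.1 i = n ∧ (∀ j, 0 ≤ m.2 j) ∧ ∑ j, m.2 j = n := by
  classical
  obtain ⟨d, hd⟩ := ne_zero_iff.mp hφ0
  have hr := fst_eq_rowCount_of_isWeightedHomogeneous hφ hd
  have hc := snd_eq_colCount_of_isWeightedHomogeneous hφ hd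
  have hdeg : ∑ p, d p = n := by
    have h := hφn hd
    rw [Finsupp.weight_apply, Finsupp.sum_fintype _ _ (fun _ => by simp)] at h
    simpa using h
  refine ⟨fun i => by rw [hr]; positivity, ?_, fun j => by rw [hc]; positivity, ?_⟩
  · simp_rw [hr, rowCount]
    rw [← hdeg, Fintype.sum_prod_type]
    push_cast
    rfl
  · simp_rw [hc, colCount]
    rw [← hdeg, Fintype.sum_prod_type, Finset.sum_comm]
    push_cast
    rfl

/-- Pigeonhole: a vector of `|ι|` non-negative integers with sum `|ι|` which is not `(1,…,1)` has
an entry `≥ 2` and an entry `= 0`. [folklore] -/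
private theorem exists_two_le_and_eq_zero {f : ι → ℤ} (h0 : ∀ i, 0 ≤ f i)
    (hsum : ∑ i, f i = Fintype.card ι) (hne : f ≠ fun _ => 1) :
    ∃ i j, 2 ≤ f i ∧ f j = 0 := by
  have h2 : ∃ i, 2 ≤ f i := by
    by_contra h
    push Not at h
    apply hne
    funext i
    have hle : ∀ k, f k ≤ 1 := fun k => by have := h k; omega
    have hsum' : ∑ k, (1 - f k) = 0 := by
      rw [Finset.sum_sub_distrib, hsum, Finset.sum_const, Finset.card_univ, nsmul_eq_mul, mul_one,
        sub_self]
    have := (Finset.sum_eq_zero_iff_of_nonneg fun k _ => sub_nonneg.mpr (hle k)).mp hsum' i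
      (Finset.mem_univ i)
    omega
  obtain ⟨i, hi⟩ := h2
  refine ⟨i, ?_⟩
  by_contra h
  push Not at h
  have h1 : ∀ j, 1 ≤ f j := fun j => by
    have := h j hi; have := h0 j; omega
  have : ∑ k, f k = f i + ∑ k ∈ Finset.univ.erase i, f k :=
    (Finset.add_sum_erase _ _ (Finset.mem_univ i)).symm
  have hrest : ((Finset.univ.erase i).card : ℤ) ≤ ∑ k ∈ Finset.univ.erase i, f k := by
    have := Finset.card_nsmul_le_sum (Finset.univ.erase i) f 1 fun k _ => h1 k
    simpa using this
  rw [Finset.card_erase_of_mem (Finset.mem_univ i), Finset.card_univ] at hrest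
  have hcard : 1 ≤ Fintype.card ι := Fintype.card_pos_iff.mpr ⟨i⟩
  push_cast [Nat.cast_sub hcard] at hrest
  omega

end Weights

/-! ### §4 Weight components of vectors of a torus-stable subspace stay in the subspace -/

section Extraction

variable {K V : Type*} [Field K] [AddCommGroup V] [Module K V]

/-- **Simultaneous-eigenvector extraction.** If `Σ_{a ∈ s} v_a ∈ p`, the subspace `p` is stable
under operators `op k` acting diagonally on the `v_a` (`op k (v_a) = c_{k,a} v_a`), and the
eigenvalue strings `(c_{k,a})_k` separate the indices `a ∈ s`, then every `v_a` lies in `p`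
(Lagrange interpolation in the commuting operators: `Π_{b ≠ a₀} (op k_b − c_{k_b,b}) ` kills the
`v_b`, `b ≠ a₀`, and rescales `v_{a₀}` by a non-zero scalar). The linear-algebra form of "a
`T`-stable subspace is the sum of its weight spaces", the first step of every weight-space argument
such as §3.4's. [cite: LandsbergManivelRessayre2013, §3.4 (p. 479)] -/
theorem mem_of_sum_mem_of_separating_ops (p : Submodule K V) {α κ : Type*} (s : Finset α)
    (v : α → V) (hv : ∑ a ∈ s, v a ∈ p) (op : κ → V →ₗ[K] V) (hop : ∀ k, ∀ x ∈ p, op k x ∈ p)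
    (c : κ → α → K) (hdiag : ∀ k, ∀ a ∈ s, op k (v a) = c k a • v a)
    (hsep : ∀ a ∈ s, ∀ b ∈ s, a ≠ b → ∃ k, c k a ≠ c k b) :
    ∀ a ∈ s, v a ∈ p := by
  classical
  intro a₀ ha₀
  -- invariant: a combination `Σ e_a v_a ∈ p` with `e_{a₀} ≠ 0` and `e_b = 0` on `t`
  have key : ∀ t : Finset α, t ⊆ s.erase a₀ →
      ∃ e : α → K, (∑ a ∈ s, e a • v a) ∈ p ∧ e a₀ ≠ 0 ∧ ∀ b ∈ t, e b = 0 := by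
    intro t
    induction t using Finset.induction_on with
    | empty =>
      intro _
      exact ⟨fun _ => 1, by simpa using hv, one_ne_zero, fun b hb => absurd hb (Finset.notMem_empty b)⟩
    | insert b t hbt ih =>
      intro hsub
      obtain ⟨e, hep, hea, het⟩ := ih ((Finset.subset_insert b t).trans hsub)
      have hb : b ∈ s.erase a₀ := hsub (Finset.mem_insert_self b t)
      obtain ⟨k, hk⟩ := hsep a₀ ha₀ b (Finset.mem_of_mem_erase hb) (Finset.ne_of_mem_erase hb).symm
      refine ⟨fun a => e a * (c k a - c k b), ?_, ?_, ?_⟩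
      · have hmem : op k (∑ a ∈ s, e a • v a) - c k b • (∑ a ∈ s, e a • v a) ∈ p :=
          p.sub_mem (hop k _ hep) (p.smul_mem _ hep)
        convert hmem using 1
        rw [map_sum, Finset.smul_sum, ← Finset.sum_sub_distrib]
        refine Finset.sum_congr rfl fun a ha => ?_
        rw [map_smul, hdiag k a ha, smul_smul, smul_smul, ← sub_smul]
        congr 1
        ring
      · exact mul_ne_zero hea (sub_ne_zero.mpr hk)
      · intro b' hb'
        dsimp only
        rcases Finset.mem_insert.mp hb' with rfl | hb't
        · rw [sub_self, mul_zero]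
        · rw [het b' hb't, zero_mul]
  obtain ⟨e, hep, hea, het⟩ := key (s.erase a₀) le_rfl
  rw [Finset.sum_eq_single_of_mem a₀ ha₀ (fun b hb hne => by
    rw [het b (Finset.mem_erase.mpr ⟨hne, hb⟩), zero_smul])] at hep
  exact (p.smul_mem_iff hea).mp hep

end Extraction

section WeightComponents

variable {ι : Type*} [Fintype ι] [DecidableEq ι]

/-- **A subspace of `ℂ[M_n]` stable under the diagonal row and column operators
`D_{E_{ii} ⊗ 1}`, `D_{1 ⊗ E_{jj}}` (the Lie algebra of the torus `T(E) × T(F)`) contains the weight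
components of its elements.** [cite: LandsbergManivelRessayre2013, §3.4 (p. 479)] -/
theorem weightedHomogeneousComponent_mem_of_stable (V : Submodule ℂ (MvPolynomial (ι × ι) ℂ))
    (hrow : ∀ i, ∀ v ∈ V, lieDer (Matrix.single i i (1 : ℂ) ⊗ₖ (1 : Matrix ι ι ℂ)) v ∈ V)
    (hcol : ∀ j, ∀ v ∈ V, lieDer ((1 : Matrix ι ι ℂ) ⊗ₖ Matrix.single j j (1 : ℂ)) v ∈ V)
    {v : MvPolynomial (ι × ι) ℂ} (hv : v ∈ V) (m : (ι → ℤ) × (ι → ℤ)) :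
    weightedHomogeneousComponent (rcWeight ι) m v ∈ V := by
  classical
  set s := (weightedHomogeneousComponent_finsupp (w := rcWeight ι) v).toFinset with hs
  by_cases hm : m ∈ s
  swap
  · have : weightedHomogeneousComponent (rcWeight ι) m v = 0 := by
      simpa [hs, Set.Finite.mem_toFinset, Function.mem_support] using hm
    rw [this]
    exact V.zero_mem
  have hsum : ∑ a ∈ s, weightedHomogeneousComponent (rcWeight ι) a v ∈ V := by
    rw [hs, ← finsum_eq_sum _ (weightedHomogeneousComponent_finsupp (w := rcWeight ι) v),
      sum_weightedHomogeneousComponent]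
    exact hv
  refine mem_of_sum_mem_of_separating_ops V s (fun a => weightedHomogeneousComponent (rcWeight ι) a v)
    hsum (κ := ι ⊕ ι)
    (Sum.elim (fun i => (lieDer (Matrix.single i i (1 : ℂ) ⊗ₖ (1 : Matrix ι ι ℂ))).toLinearMap)
      (fun j => (lieDer ((1 : Matrix ι ι ℂ) ⊗ₖ Matrix.single j j (1 : ℂ))).toLinearMap))
    ?_ (Sum.elim (fun i a => (a.1 i : ℂ)) (fun j a => (a.2 j : ℂ))) ?_ ?_ m hm
  · rintro (i | j) x hx
    · exact hrow i x hx
    · exact hcol j x hx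
  · rintro (i | j) a _
    · change lieDer _ _ = _
      rw [lieDer_single_kronecker_one]
      exact sum_X_mul_pderiv_row_of_isWeightedHomogeneous
        (weightedHomogeneousComponent_isWeightedHomogeneous a v) i
    · change lieDer _ _ = _
      rw [lieDer_one_kronecker_single]
      exact sum_X_mul_pderiv_col_of_isWeightedHomogeneous
        (weightedHomogeneousComponent_isWeightedHomogeneous a v) j
  · intro a _ b _ hab
    by_contra h
    push Not at h
    apply hab
    refine Prod.ext (funext fun i => ?_) (funext fun j => ?_)
    · have := h (Sum.inl i)
      simp only [Sum.elim_inl] at this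
      exact_mod_cast this
    · have := h (Sum.inr j)
      simp only [Sum.elim_inr] at this
      exact_mod_cast this

end WeightComponents

/-! ### §5 From group stability to Lie-algebra stability: the `ε`-coefficient of `(1 + εN)·v` -/

section LieFromGroup

variable {σ : Type*} [Fintype σ] [DecidableEq σ]

/-- The substitution `1 + tN` on a variable: `x_c ↦ x_c + t · D_N x_c`.
[cite: LandsbergManivelRessayre2013, §3.3 (p. 477)] -/
theorem linSubst_one_add_smul_X (t : ℂ) (N : Matrix σ σ ℂ) (c : σ) :
    linSubst σ ℂ (1 + t • N) (X c) = X c + t • lieDer N (X c) := by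
  rw [linSubst_X, lieDer_X, Finset.smul_sum]
  simp only [Matrix.add_apply, Matrix.one_apply, Matrix.smul_apply, smul_eq_mul, add_smul, ite_smul,
    one_smul, zero_smul, Finset.sum_add_distrib, Finset.sum_ite_eq', Finset.mem_univ, if_true,
    mul_smul]

/-- The one-parameter curve `t ↦ (1 + tN)·p` as a polynomial in `t` with coefficients in `ℂ[W]`:
the algebra map `x_c ↦ x_c + t · D_N x_c` into `ℂ[W][t]`. Private plumbing. [folklore] -/
private def curvePoly (N : Matrix σ σ ℂ) :
    MvPolynomial σ ℂ →ₐ[ℂ] Polynomial (MvPolynomial σ ℂ) :=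
  MvPolynomial.aeval fun c => Polynomial.C (X c) + Polynomial.X * Polynomial.C (lieDer N (X c))

omit [DecidableEq σ] in
/-- The curve on a variable. [folklore] -/
private theorem curvePoly_X (N : Matrix σ σ ℂ) (c : σ) :
    curvePoly N (X c) = Polynomial.C (X c) + Polynomial.X * Polynomial.C (lieDer N (X c)) := by
  rw [curvePoly, MvPolynomial.aeval_X]

omit [DecidableEq σ] in
/-- The curve on a constant. [folklore] -/
private theorem curvePoly_C (N : Matrix σ σ ℂ) (a : ℂ) :
    curvePoly N (C a) = Polynomial.C (C a) := by
  rw [curvePoly, MvPolynomial.aeval_C, Polynomial.algebraMap_apply, MvPolynomial.algebraMap_eq]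

/-- Evaluating the curve at `t` gives the substitution `(1 + tN)·p`. [folklore] -/
private theorem eval_curvePoly (N : Matrix σ σ ℂ) (t : ℂ) (p : MvPolynomial σ ℂ) :
    (curvePoly N p).eval (C t) = linSubst σ ℂ (1 + t • N) p := by
  induction p using MvPolynomial.induction_on with
  | C a => rw [curvePoly_C, Polynomial.eval_C, linSubst_C]
  | add p q hp hq => rw [map_add, Polynomial.eval_add, hp, hq, map_add]
  | mul_X p c hp =>
    rw [map_mul, Polynomial.eval_mul, hp, map_mul, curvePoly_X, Polynomial.eval_add, Polynomial.eval_mul,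
      Polynomial.eval_C, Polynomial.eval_X, Polynomial.eval_C, linSubst_one_add_smul_X,
      MvPolynomial.smul_eq_C_mul]

/-- The constant coefficient of the curve is `p` itself. [folklore] -/
private theorem coeff_curvePoly_zero (N : Matrix σ σ ℂ) (p : MvPolynomial σ ℂ) :
    (curvePoly N p).coeff 0 = p := by
  rw [Polynomial.coeff_zero_eq_eval_zero, ← C_0, eval_curvePoly, zero_smul, add_zero, linSubst_one,
    AlgHom.id_apply]

/-- **The `t`-coefficient of `(1 + tN)·p` is `D_N p`.** [cite: LandsbergManivelRessayre2013, §3.3 (p. 477)] -/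
private theorem coeff_curvePoly_one (N : Matrix σ σ ℂ) (p : MvPolynomial σ ℂ) :
    (curvePoly N p).coeff 1 = lieDer N p := by
  induction p using MvPolynomial.induction_on with
  | C a => rw [curvePoly_C, Polynomial.coeff_C, if_neg one_ne_zero, MvPolynomial.derivation_C]
  | add p q hp hq => rw [map_add, Polynomial.coeff_add, hp, hq, map_add]
  | mul_X p c hp =>
    rw [map_mul, curvePoly_X, mul_add, ← mul_assoc, Polynomial.coeff_add, Polynomial.coeff_mul_C,
      Polynomial.coeff_mul_C, Polynomial.coeff_mul_X, hp, coeff_curvePoly_zero, Derivation.leibniz,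
      smul_eq_mul, smul_eq_mul]
    ring

/-- **Lie-algebra stability from group stability.** If a subspace `V ⊆ ℂ[W]` is stable under the
substitutions `1 + tN` for infinitely many `t` (e.g. a one-parameter subgroup of the stabiliser of
`[P]` acting on `T̂_{[P]}𝒟ual`), then `V` is stable under the derivation `D_N` (differentiate at
`t = 0`: a linear form vanishing on `V` kills every Taylor coefficient of `t ↦ (1+tN)·v`).
[cite: LandsbergManivelRessayre2013, §3.3–§3.4 (pp. 477–479)] -/
theorem lieDer_mem_of_linSubst_mem (V : Submodule ℂ (MvPolynomial σ ℂ)) (N : Matrix σ σ ℂ)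
    {U : Set ℂ} (hU : U.Infinite) (h : ∀ t ∈ U, ∀ v ∈ V, linSubst σ ℂ (1 + t • N) v ∈ V)
    {v : MvPolynomial σ ℂ} (hv : v ∈ V) : lieDer N v ∈ V := by
  classical
  by_contra hnot
  obtain ⟨φ, hφ, hφV⟩ := Submodule.exists_dual_map_eq_bot_of_notMem hnot inferInstance
  have hφV' : ∀ x ∈ V, φ x = 0 := fun x hx => by
    have : φ x ∈ V.map φ := Submodule.mem_map_of_mem hx
    rwa [hφV, Submodule.mem_bot] at this
  -- the scalar polynomial `q(t) = φ((1+tN)·v)`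
  set P := curvePoly N v with hP
  set q : Polynomial ℂ := ∑ k ∈ Finset.range (P.natDegree + 2), Polynomial.monomial k (φ (P.coeff k))
    with hq
  have hqeval : ∀ t : ℂ, q.eval t = φ (linSubst σ ℂ (1 + t • N) v) := fun t => by
    rw [← eval_curvePoly, Polynomial.eval_eq_sum_range' (Nat.lt_succ_of_lt (Nat.lt_succ_self _)) (C t),
      map_sum, hq, Polynomial.eval_finsetSum]
    refine Finset.sum_congr rfl fun k _ => ?_
    rw [Polynomial.eval_monomial, ← map_pow, mul_comm (P.coeff k), ← MvPolynomial.smul_eq_C_mul,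
      map_smul, smul_eq_mul, mul_comm]
  have hq0 : q = 0 := by
    refine Polynomial.eq_zero_of_infinite_isRoot q (hU.mono fun t ht => ?_)
    rw [Set.mem_setOf_eq, Polynomial.IsRoot.def, hqeval]
    exact hφV' _ (h t ht v hv)
  have hq1 : q.coeff 1 = φ (lieDer N v) := by
    rw [hq, Polynomial.finsetSum_coeff]
    simp only [Polynomial.coeff_monomial, Finset.sum_ite_eq', Finset.mem_range]
    rw [if_pos (by omega), hP, coeff_curvePoly_one]
  rw [hq0, Polynomial.coeff_zero] at hq1
  exact hφ hq1.symm

end LieFromGroup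

/-! ### §6 Permutations: renaming rows/columns, and the transport `ℂ[𝔖_n] → span{x^{μ_ρ}}` -/

section Rename

variable {σ : Type*} [Fintype σ] [DecidableEq σ]

omit [DecidableEq σ] in
/-- Renaming the variables by a permutation `e` conjugates `D_Z` into `D_{Z^e}`,
`Z^e_{b,b'} = Z_{e⁻¹b, e⁻¹b'}`. [cite: LandsbergManivelRessayre2013, §3.4 (p. 479)] -/
theorem rename_lieDer (e : Equiv.Perm σ) (Z : Matrix σ σ ℂ) (p : MvPolynomial σ ℂ) :
    rename e (lieDer Z p) = lieDer (Z.submatrix e.symm e.symm) (rename e p) := by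
  induction p using MvPolynomial.induction_on with
  | C a => rw [MvPolynomial.derivation_C, rename_C, MvPolynomial.derivation_C, map_zero]
  | add p q hp hq => rw [map_add, map_add, hp, hq, map_add, map_add]
  | mul_X p c hp =>
    have hXc : rename e (lieDer Z (X c)) = lieDer (Z.submatrix e.symm e.symm) (X (e c)) := by
      rw [lieDer_X, lieDer_X, map_sum]
      simp only [MvPolynomial.smul_eq_C_mul, map_mul, rename_C, rename_X, Matrix.submatrix_apply,
        Equiv.symm_apply_apply]
      exact Fintype.sum_equiv e _ _ fun a => by rw [Equiv.symm_apply_apply]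
    rw [Derivation.leibniz, smul_eq_mul, smul_eq_mul, map_add, map_mul, map_mul, hp, hXc, rename_X,
      map_mul, rename_X, Derivation.leibniz, smul_eq_mul, smul_eq_mul]

/-- **`𝔤𝔩(W)·P` is stable under a renaming of the variables fixing `P` up to a scalar**
(`e·(Z·P) = Z^e·(e·P) = c · Z^e·P`). [cite: LandsbergManivelRessayre2013, §3.4 (p. 479)] -/
theorem rename_mem_glTangent_of_rename_eq_smul {P : MvPolynomial σ ℂ} (e : Equiv.Perm σ) {c : ℂ}
    (he : rename e P = c • P) {p : MvPolynomial σ ℂ} (hp : p ∈ glTangent P) :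
    rename e p ∈ glTangent P := by
  rw [← range_glTangentMap] at hp ⊢
  obtain ⟨Z, rfl⟩ := hp
  rw [← lieDer_apply, rename_lieDer, he, Derivation.map_smul, lieDer_apply]
  exact Submodule.smul_mem _ _ (LinearMap.mem_range_self _ _)

/-- **`T̂_{[P]}𝒟ual_{k,d,N}` is stable under a renaming of the variables fixing `P` up to a non-zero
scalar** (a renaming is the substitution by a permutation matrix, `linSubst_permMatrix`; then
`linSubst_mem_lmrZariskiTangent_of_linSubst_eq_smul`, `LMR13DualSchemeEquivariance.lean`).
[cite: LandsbergManivelRessayre2013, §3.4 (p. 478)] -/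
theorem rename_mem_lmrZariskiTangent_of_rename_eq_smul {κ d : ℕ} {P π : MvPolynomial σ ℂ}
    (e : Equiv.Perm σ) {c : ℂ} (hc : c ≠ 0) (he : rename e P = c • P)
    (hπ : π ∈ lmrZariskiTangent κ d P) : rename e π ∈ lmrZariskiTangent κ d P := by
  have hsub : (linSubst σ ℂ (Equiv.Perm.permMatrix ℂ e.symm) : MvPolynomial σ ℂ → MvPolynomial σ ℂ) =
      rename e := by
    rw [linSubst_permMatrix, Equiv.symm_symm]
  have h := linSubst_mem_lmrZariskiTangent_of_linSubst_eq_smul (Equiv.Perm.permMatrix ℂ e.symm) hc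
    (by rw [hsub, he]) hπ
  rwa [hsub] at h

end Rename

section PermMonomials

variable {ι : Type*} [Fintype ι] [DecidableEq ι]

omit [DecidableEq ι] in
/-- Permuting the rows of a permutation pattern: `(g × 1) · μ_ρ = μ_{gρ}` (the `𝔖_n × 𝔖_n`-action on
the permutation monomials, §3.4). [cite: LandsbergManivelRessayre2013, §3.4 (p. 478)] -/
theorem mapDomain_rowPerm_permMonomial (g ρ : Equiv.Perm ι) :
    Finsupp.mapDomain (Prod.map g id) (permMonomial ρ) = permMonomial (g * ρ) := by
  rw [permMonomial, permMonomial, Finsupp.mapDomain_finsetSum]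
  exact Finset.sum_congr rfl fun i _ => by rw [Finsupp.mapDomain_single]; rfl

omit [DecidableEq ι] in
/-- Permuting the columns: `(1 × g) · μ_ρ = μ_{ρ g⁻¹}`. [cite: LandsbergManivelRessayre2013, §3.4 (p. 478)] -/
theorem mapDomain_colPerm_permMonomial (g ρ : Equiv.Perm ι) :
    Finsupp.mapDomain (Prod.map id g) (permMonomial ρ) = permMonomial (ρ * g⁻¹) := by
  rw [permMonomial, permMonomial, Finsupp.mapDomain_finsetSum]
  simp only [Finsupp.mapDomain_single, Prod.map_apply, id_eq]
  exact Fintype.sum_equiv g _ _ fun i => by simp [Equiv.Perm.mul_apply]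

omit [DecidableEq ι] in
/-- The row-indexed permutation monomial of `immanant`: `∏_i x_{i σ(i)} = x^{μ_{σ⁻¹}}`
("`IM_π = Σ_σ χ_π(σ) x_{1σ(1)}⋯x_{nσ(n)}`", §3.4). [cite: LandsbergManivelRessayre2013, §3.4 (p. 478)] -/
theorem prod_X_row_eq_monomial_permMonomial (σ' : Equiv.Perm ι) :
    ∏ i, (X (i, σ' i) : MvPolynomial (ι × ι) ℂ) = monomial (permMonomial σ'⁻¹) 1 := by
  rw [permMonomial, monomial_sum_one]
  have h : ∀ i, (X (i, σ' i) : MvPolynomial (ι × ι) ℂ) = monomial (Finsupp.single (i, σ' i) 1) 1 :=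
    fun i => rfl
  simp_rw [h]
  exact Fintype.prod_equiv σ' _ _ fun i => by
    rw [show σ'⁻¹ (σ' i) = i from σ'.symm_apply_apply i]

/-- `det_n` is an alternating function of the rows: renaming `x_{rc} ↦ x_{g(r) c}` multiplies it by
`sgn g` (the permutation matrices of `GL(E)` stabilise `[det_n]`). [cite: LandsbergManivelRessayre2013, §3.4 (p. 478)] -/
theorem rename_rowPerm_detPoly (g : Equiv.Perm ι) :
    rename (Prod.map g id) (detPoly ι ℂ) = (((Equiv.Perm.sign g : ℤˣ) : ℤ) : ℂ) • detPoly ι ℂ := by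
  rw [detPoly_eq_sum_monomial, map_sum, Finset.smul_sum]
  simp only [rename_monomial, mapDomain_rowPerm_permMonomial, smul_monomial]
  refine Fintype.sum_equiv (Equiv.mulLeft g) _ _ fun ρ => ?_
  simp only [Equiv.coe_mulLeft, map_mul, Units.val_mul, Int.cast_mul, smul_eq_mul]
  congr 1
  rcases Int.units_eq_one_or (Equiv.Perm.sign g) with h | h <;> simp [h]

/-- Columns: renaming `x_{rc} ↦ x_{r g(c)}` multiplies `det_n` by `sgn g`. [cite: LandsbergManivelRessayre2013, §3.4 (p. 478)] -/
theorem rename_colPerm_detPoly (g : Equiv.Perm ι) :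
    rename (Prod.map id g) (detPoly ι ℂ) = (((Equiv.Perm.sign g : ℤˣ) : ℤ) : ℂ) • detPoly ι ℂ := by
  rw [detPoly_eq_sum_monomial, map_sum, Finset.smul_sum]
  simp only [rename_monomial, mapDomain_colPerm_permMonomial, smul_monomial]
  refine Fintype.sum_equiv (Equiv.mulRight g⁻¹) _ _ fun ρ => ?_
  simp only [Equiv.coe_mulRight, map_mul, map_inv, Units.val_mul, Int.cast_mul, smul_eq_mul]
  rcases Int.units_eq_one_or (Equiv.Perm.sign g) with h | h <;> simp [h]

/-- A square array of naturals with unit row and column sums is a permutation pattern (the monomials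
of weight `(1ⁿ;1ⁿ)` are the `x_{1σ(1)}⋯x_{nσ(n)}`, §3.4). [cite: LandsbergManivelRessayre2013, §3.4 (p. 478)] -/
theorem exists_permMonomial_eq_of_counts_eq_one {d : ι × ι →₀ ℕ} (hr : ∀ r, rowCount d r = 1)
    (hc : ∀ c, colCount d c = 1) : ∃ π : Equiv.Perm ι, permMonomial π = d := by
  classical
  have hex : ∀ c, ∃ r, d (r, c) = 1 ∧ ∀ r', r' ≠ r → d (r', c) = 0 := by
    intro c
    have h1 : ∑ r, d (r, c) = 1 := hc c
    obtain ⟨r, -, hr0⟩ := Finset.exists_ne_zero_of_sum_ne_zero (h1.symm ▸ one_ne_zero : ∑ r, d (r, c) ≠ 0)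
    have hsplit := Finset.add_sum_erase Finset.univ (fun r => d (r, c)) (Finset.mem_univ r)
    rw [h1] at hsplit
    have hdr : d (r, c) = 1 := by omega
    refine ⟨r, hdr, fun r' hr' => ?_⟩
    have hrest : ∑ x ∈ Finset.univ.erase r, d (x, c) = 0 := by omega
    exact Finset.sum_eq_zero_iff.mp hrest r' (Finset.mem_erase.mpr ⟨hr', Finset.mem_univ r'⟩)
  choose f hf1 hf0 using hex
  have hinj : Function.Injective f := by
    intro c c' hcc'
    by_contra hne
    have h2 : ∑ x ∈ ({c, c'} : Finset ι), d (f c, x) ≤ rowCount d (f c) :=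
      Finset.sum_le_sum_of_subset_of_nonneg (Finset.subset_univ _) fun _ _ _ => Nat.zero_le _
    rw [Finset.sum_pair hne, hr, hf1 c, hcc', hf1 c'] at h2
    omega
  refine ⟨Equiv.ofBijective f (Finite.injective_iff_bijective.mp hinj), Finsupp.ext fun ⟨r, c⟩ => ?_⟩
  rw [permMonomial_apply, Equiv.ofBijective_apply]
  split_ifs with h
  · rw [← h]; exact (hf1 c).symm
  · exact (hf0 c r (Ne.symm h)).symm

/-- The monomials of a weight-`(1,…,1;1,…,1)` form are permutation monomials `x^{μ_ρ}`, so such a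
form lies in the span of the `x^{μ_ρ}` (the `(1ⁿ;1ⁿ)`-weight space `≅ ℂ[𝔖_n]` of `Sⁿ(E ⊗ F)`).
[cite: LandsbergManivelRessayre2013, §3.4 (p. 479)] -/
theorem mem_span_permMonomial_of_isWeightedHomogeneous {p : MvPolynomial (ι × ι) ℂ}
    (hp : IsWeightedHomogeneous (rcWeight ι) p ((fun _ => 1), (fun _ => 1))) :
    p ∈ Submodule.span ℂ (Set.range fun ρ : Equiv.Perm ι =>
      (monomial (permMonomial ρ) (1 : ℂ) : MvPolynomial (ι × ι) ℂ)) := by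
  classical
  rw [p.as_sum]
  refine Submodule.sum_mem _ fun d hd => ?_
  have hd' := hp (mem_support_iff.mp hd)
  rw [weight_rcWeight, Prod.mk.injEq] at hd'
  obtain ⟨ρ, hρ⟩ := exists_permMonomial_eq_of_counts_eq_one (d := d)
    (fun r => by have := congrFun hd'.1 r; exact_mod_cast this)
    (fun c => by have := congrFun hd'.2 c; exact_mod_cast this)
  rw [← hρ, ← mul_one (coeff (permMonomial ρ) p), ← smul_eq_mul, ← smul_monomial]
  exact Submodule.smul_mem _ _ (Submodule.subset_span ⟨ρ, rfl⟩)

end PermMonomials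

section Transport

variable (ι : Type) [Fintype ι]

/-- **The transport `Φ : ℂ[𝔖_ι] → ℂ[M_ι]`, `ρ ↦ x^{μ_ρ} = ∏_c x_{ρ(c) c}`** (linear), identifying the
group algebra with the span of the permutation monomials — the `(1ⁿ;1ⁿ)`-weight space of
`Sⁿ(E ⊗ F)`, on which `𝔖_n × 𝔖_n` acts by row and column permutations (§3.4: the immanants
`IM_π` are the images of the characters). [cite: LandsbergManivelRessayre2013, §3.4 (p. 478)] -/
def permPoly : MonoidAlgebra ℂ (Equiv.Perm ι) →ₗ[ℂ] MvPolynomial (ι × ι) ℂ :=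
  Finsupp.linearCombination ℂ (fun ρ : Equiv.Perm ι =>
      (monomial (permMonomial ρ) (1 : ℂ) : MvPolynomial (ι × ι) ℂ)) ∘ₗ
    (MonoidAlgebra.coeffLinearEquiv ℂ).toLinearMap

variable {ι}

/-- `Φ(c·ρ) = c x^{μ_ρ}`. [cite: LandsbergManivelRessayre2013, §3.4 (p. 478)] -/
theorem permPoly_single (ρ : Equiv.Perm ι) (c : ℂ) :
    permPoly ι (MonoidAlgebra.single ρ c) = monomial (permMonomial ρ) c := by
  rw [permPoly, LinearMap.comp_apply, LinearEquiv.coe_toLinearMap, MonoidAlgebra.coeffLinearEquiv_apply,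
    MonoidAlgebra.coeff_single, Finsupp.linearCombination_single, smul_monomial, smul_eq_mul, mul_one]

/-- `Φ(ρ) = x^{μ_ρ}`. [cite: LandsbergManivelRessayre2013, §3.4 (p. 478)] -/
theorem permPoly_of (ρ : Equiv.Perm ι) :
    permPoly ι (MonoidAlgebra.of ℂ (Equiv.Perm ι) ρ) = monomial (permMonomial ρ) 1 := by
  rw [MonoidAlgebra.of_apply, permPoly_single]

/-- The image of `Φ` is the span of the permutation monomials. [cite: LandsbergManivelRessayre2013, §3.4 (p. 478)] -/
theorem range_permPoly :
    LinearMap.range (permPoly ι) = Submodule.span ℂ (Set.range fun ρ : Equiv.Perm ι =>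
      (monomial (permMonomial ρ) (1 : ℂ) : MvPolynomial (ι × ι) ℂ)) := by
  rw [permPoly, LinearMap.range_comp_of_range_eq_top _ (LinearEquiv.range _),
    Finsupp.range_linearCombination]

/-- **Row permutations are left multiplication**: `(g × 1)·Φ(a) = Φ(g a)`.
[cite: LandsbergManivelRessayre2013, §3.4 (p. 478)] -/
theorem rename_rowPerm_permPoly (g : Equiv.Perm ι) (a : MonoidAlgebra ℂ (Equiv.Perm ι)) :
    rename (Prod.map g id) (permPoly ι a) = permPoly ι (MonoidAlgebra.of ℂ (Equiv.Perm ι) g * a) := by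
  induction a using MonoidAlgebra.induction_linear with
  | zero => rw [mul_zero, map_zero, map_zero]
  | add a b ha hb => rw [mul_add, map_add, map_add, ha, hb, map_add]
  | single ρ c =>
    rw [permPoly_single, rename_monomial, mapDomain_rowPerm_permMonomial, MonoidAlgebra.of_apply,
      MonoidAlgebra.single_mul_single, one_mul, permPoly_single]

/-- **Column permutations are right multiplication**: `(1 × g)·Φ(a) = Φ(a g⁻¹)`.
[cite: LandsbergManivelRessayre2013, §3.4 (p. 478)] -/
theorem rename_colPerm_permPoly (g : Equiv.Perm ι) (a : MonoidAlgebra ℂ (Equiv.Perm ι)) :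
    rename (Prod.map id g) (permPoly ι a) = permPoly ι (a * MonoidAlgebra.of ℂ (Equiv.Perm ι) g⁻¹) := by
  induction a using MonoidAlgebra.induction_linear with
  | zero => rw [zero_mul, map_zero, map_zero]
  | add a b ha hb => rw [add_mul, map_add, map_add, ha, hb, map_add]
  | single ρ c =>
    rw [permPoly_single, rename_monomial, mapDomain_colPerm_permMonomial, MonoidAlgebra.of_apply,
      MonoidAlgebra.single_mul_single, mul_one, permPoly_single]

/-- **`Φ(e_{χ_λ}) = (f^λ/n!) · IM_λ`**: the central idempotent of the Specht character `χ_λ` goes to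
a non-zero multiple of the immanant `IM_λ = Σ_σ χ_λ(σ) ∏_i x_{iσ(i)}` (no integrality or realness
of `χ_λ` is needed: `∏_i x_{iσ(i)} = x^{μ_{σ⁻¹}}`). [cite: LandsbergManivelRessayre2013, §3.4 (p. 478)] -/
theorem permPoly_charIdempotent_spechtCharacter {n : ℕ} (lam : Nat.Partition n) :
    permPoly (Fin n) (charIdempotent (spechtCharacter ℂ lam)) =
      (spechtCharacter ℂ lam 1 / (Fintype.card (Equiv.Perm (Fin n)) : ℂ)) • immanant lam := by
  rw [charIdempotent, map_sum, immanant, Finset.smul_sum]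
  simp only [map_smul, permPoly_of, prod_X_row_eq_monomial_permMonomial, smul_smul]
  refine Fintype.sum_equiv (Equiv.inv (Equiv.Perm (Fin n))) _ _ fun g => ?_
  simp only [Equiv.inv_apply, inv_inv]

end Transport

/-! ### §7 The weight reduction: a `GL(E)×GL(F)`-stable `V` lies in a `GL(E)×GL(F)`-stable `T` as soon
as its `(1ⁿ;1ⁿ)`-weight vectors do -/

section Reduction

variable {ι : Type*} [Fintype ι] [DecidableEq ι]

/-- The descent measure `Σ_i α_i² + Σ_j β_j²` of a weight `(α, β)`. Private plumbing. [folklore] -/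
private def wtMeasure (m : (ι → ℤ) × (ι → ℤ)) : ℤ := ∑ i, m.1 i ^ 2 + ∑ j, m.2 j ^ 2

omit [DecidableEq ι] in
/-- The descent measure is non-negative. [folklore] -/
private theorem wtMeasure_nonneg (m : (ι → ℤ) × (ι → ℤ)) : 0 ≤ wtMeasure m :=
  add_nonneg (Finset.sum_nonneg fun _ _ => sq_nonneg _) (Finset.sum_nonneg fun _ _ => sq_nonneg _)

/-- Moving one unit from an entry `≥ 2` to an entry `= 0` lowers the sum of squares by at least `2`.
[folklore] -/
private theorem sum_sq_shift_le {f : ι → ℤ} {i j : ι} (hi : 2 ≤ f i) (hj : f j = 0) :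
    ∑ k, (f k + ((Pi.single j (1 : ℤ) : ι → ℤ) k - (Pi.single i (1 : ℤ) : ι → ℤ) k)) ^ 2 + 2 ≤
      ∑ k, f k ^ 2 := by
  have hij : i ≠ j := by rintro rfl; omega
  have hexp : ∀ k, (f k + ((Pi.single j (1 : ℤ) : ι → ℤ) k - (Pi.single i (1 : ℤ) : ι → ℤ) k)) ^ 2 =
      f k ^ 2 + (2 * f k * ((Pi.single j (1 : ℤ) : ι → ℤ) k - (Pi.single i (1 : ℤ) : ι → ℤ) k) +
        ((Pi.single j (1 : ℤ) : ι → ℤ) k - (Pi.single i (1 : ℤ) : ι → ℤ) k) ^ 2) := fun k => by ring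
  simp_rw [hexp]
  rw [Finset.sum_add_distrib, Finset.sum_add_distrib]
  have h1 : ∑ k, 2 * f k * ((Pi.single j (1 : ℤ) : ι → ℤ) k - (Pi.single i (1 : ℤ) : ι → ℤ) k) =
      2 * f j - 2 * f i := by
    simp only [mul_sub, Finset.sum_sub_distrib, Pi.single_apply, mul_ite, mul_one, mul_zero,
      Finset.sum_ite_eq', Finset.mem_univ, if_true]
  have h2 : ∑ k, ((Pi.single j (1 : ℤ) : ι → ℤ) k - (Pi.single i (1 : ℤ) : ι → ℤ) k) ^ 2 = 2 := by
    rw [Finset.sum_eq_add_of_mem i j (Finset.mem_univ i) (Finset.mem_univ j) hij]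
    · simp [hij, hij.symm]
    · intro k _ hk
      simp [hk.1, hk.2]
  rw [h1, h2, hj]
  omega

omit [DecidableEq ι] in
/-- A row move lowers the measure by at least `2`. [folklore] -/
private theorem wtMeasure_row_lt {m : (ι → ℤ) × (ι → ℤ)} {i j : ι} [DecidableEq ι] (hi : 2 ≤ m.1 i)
    (hj : m.1 j = 0) : wtMeasure (m + (Pi.single j 1 - Pi.single i 1, 0)) + 2 ≤ wtMeasure m := by
  unfold wtMeasure
  simp only [Prod.fst_add, Prod.snd_add, Pi.add_apply, Pi.sub_apply, Pi.zero_apply, add_zero]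
  have := sum_sq_shift_le (f := m.1) hi hj
  omega

omit [DecidableEq ι] in
/-- A column move lowers the measure by at least `2`. [folklore] -/
private theorem wtMeasure_col_lt {m : (ι → ℤ) × (ι → ℤ)} {i j : ι} [DecidableEq ι] (hi : 2 ≤ m.2 i)
    (hj : m.2 j = 0) : wtMeasure (m + (0, Pi.single j 1 - Pi.single i 1)) + 2 ≤ wtMeasure m := by
  unfold wtMeasure
  simp only [Prod.fst_add, Prod.snd_add, Pi.add_apply, Pi.sub_apply, Pi.zero_apply, add_zero]
  have := sum_sq_shift_le (f := m.2) hi hj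
  omega

/-- **The weight reduction (heart of the isotypic step).** Let `V, T ⊆ ℂ[E ⊗ F]` (`dim E = dim F =
|ι|`) be subspaces stable under all row operators `D_{E_{ij} ⊗ 1}` and column operators
`D_{1 ⊗ E_{ij}}` (the Lie algebra `𝔤𝔩(E) ⊕ 𝔤𝔩(F)`), with `V` consisting of forms of degree `|ι|`.
If every `(1ⁿ;1ⁿ)`-weight vector of `V` lies in `T`, then `V ⊆ T`. Proof: a weight vector `u ∈ V`
of weight `(α, β) ≠ (1ⁿ;1ⁿ)` has some `α_i ≥ 2` and `α_j = 0` (or the same for `β`); then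
`E_{i←j} u = 0` and `[E_{i←j}, E_{j←i}] u = (α_i − α_j) u`, so `E_{j←i} u ∈ T ⇒ u ∈ T`; induct on
`Σα² + Σβ²`. This replaces the multiplicity-free decomposition of `Sⁿ(E ⊗ F)` used in print
(§3.4: "`T̂_{[det_n]}` … is a sum of irreducible `GL(E)×GL(F)`-modules … `S_πE ⊗ S_πF`").
[cite: LandsbergManivelRessayre2013, §3.4 (pp. 478–479)] -/
theorem le_of_rowCol_stable_of_weightOne {V T : Submodule ℂ (MvPolynomial (ι × ι) ℂ)}
    (hVhom : ∀ v ∈ V, v.IsHomogeneous (Fintype.card ι))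
    (hVrow : ∀ i j : ι, ∀ v ∈ V, lieDer (Matrix.single i j (1 : ℂ) ⊗ₖ (1 : Matrix ι ι ℂ)) v ∈ V)
    (hVcol : ∀ i j : ι, ∀ v ∈ V, lieDer ((1 : Matrix ι ι ℂ) ⊗ₖ Matrix.single i j (1 : ℂ)) v ∈ V)
    (hTrow : ∀ i j : ι, ∀ p ∈ T, lieDer (Matrix.single i j (1 : ℂ) ⊗ₖ (1 : Matrix ι ι ℂ)) p ∈ T)
    (hTcol : ∀ i j : ι, ∀ p ∈ T, lieDer ((1 : Matrix ι ι ℂ) ⊗ₖ Matrix.single i j (1 : ℂ)) p ∈ T)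
    (hM : ∀ v ∈ V, IsWeightedHomogeneous (rcWeight ι) v ((fun _ => 1), (fun _ => 1)) → v ∈ T) :
    V ≤ T := by
  classical
  -- descent on the measure of the weight
  have descent : ∀ (K : ℕ) (m : (ι → ℤ) × (ι → ℤ)), (wtMeasure m).toNat < K →
      ∀ u ∈ V, IsWeightedHomogeneous (rcWeight ι) u m → u ∈ T := by
    intro K
    induction K with
    | zero => intro m hm; exact absurd hm (Nat.not_lt_zero _)
    | succ K ih =>
      intro m hm u huV hum
      by_cases hu0 : u = 0
      · rw [hu0]; exact T.zero_mem
      obtain ⟨hpos1, hsum1, hpos2, hsum2⟩ := rowContent_nonneg_sum_eq hum (hVhom u huV) hu0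
      by_cases hrow : m.1 = fun _ => 1
      · by_cases hcol : m.2 = fun _ => 1
        · refine hM u huV ?_
          rwa [show m = ((fun _ => (1 : ℤ)), (fun _ => (1 : ℤ))) from Prod.ext hrow hcol] at hum
        · -- column descent
          obtain ⟨i, j, hi, hj⟩ := exists_two_le_and_eq_zero hpos2 hsum2 hcol
          have hFuV : lieDer ((1 : Matrix ι ι ℂ) ⊗ₖ Matrix.single j i (1 : ℂ)) u ∈ V := hVcol j i u huV
          have hFu_wt : IsWeightedHomogeneous (rcWeight ι)
              (lieDer ((1 : Matrix ι ι ℂ) ⊗ₖ Matrix.single j i (1 : ℂ)) u)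
              (m + (0, Pi.single j 1 - Pi.single i 1)) := by
            rw [lieDer_one_kronecker_single]; exact isWeightedHomogeneous_colOp hum i j
          have hlt : (wtMeasure (m + (0, Pi.single j 1 - Pi.single i 1))).toNat < K := by
            have h1 := wtMeasure_col_lt hi hj
            have h2 := wtMeasure_nonneg (m + (0, Pi.single j 1 - Pi.single i 1))
            omega
          have hFuT := ih _ hlt _ hFuV hFu_wt
          have hEu : lieDer ((1 : Matrix ι ι ℂ) ⊗ₖ Matrix.single i j (1 : ℂ)) u = 0 := by
            rw [lieDer_one_kronecker_single]; exact sum_X_mul_pderiv_eq_zero_of_col_eq_zero hum hj i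
          have hcomm := lieDer_lieDer_sub ((1 : Matrix ι ι ℂ) ⊗ₖ Matrix.single i j (1 : ℂ))
            ((1 : Matrix ι ι ℂ) ⊗ₖ Matrix.single j i (1 : ℂ)) u
          rw [hEu, map_zero, sub_zero, one_kronecker_single_comm, lieDer_sub, Derivation.sub_apply,
            lieDer_one_kronecker_single i i u, lieDer_one_kronecker_single j j u,
            sum_X_mul_pderiv_col_of_isWeightedHomogeneous hum i,
            sum_X_mul_pderiv_col_of_isWeightedHomogeneous hum j, hj, Int.cast_zero, zero_smul,
            sub_zero] at hcomm
          have hmem : ((m.2 i : ℤ) : ℂ) • u ∈ T := by rw [← hcomm]; exact hTcol i j _ hFuT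
          have hne : ((m.2 i : ℤ) : ℂ) ≠ 0 := by exact_mod_cast (show m.2 i ≠ 0 by omega)
          exact (T.smul_mem_iff hne).mp hmem
      · -- row descent
        obtain ⟨i, j, hi, hj⟩ := exists_two_le_and_eq_zero hpos1 hsum1 hrow
        have hFuV : lieDer (Matrix.single j i (1 : ℂ) ⊗ₖ (1 : Matrix ι ι ℂ)) u ∈ V := hVrow j i u huV
        have hFu_wt : IsWeightedHomogeneous (rcWeight ι)
            (lieDer (Matrix.single j i (1 : ℂ) ⊗ₖ (1 : Matrix ι ι ℂ)) u)
            (m + (Pi.single j 1 - Pi.single i 1, 0)) := by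
          rw [lieDer_single_kronecker_one]; exact isWeightedHomogeneous_rowOp hum i j
        have hlt : (wtMeasure (m + (Pi.single j 1 - Pi.single i 1, 0))).toNat < K := by
          have h1 := wtMeasure_row_lt hi hj
          have h2 := wtMeasure_nonneg (m + (Pi.single j 1 - Pi.single i 1, 0))
          omega
        have hFuT := ih _ hlt _ hFuV hFu_wt
        have hEu : lieDer (Matrix.single i j (1 : ℂ) ⊗ₖ (1 : Matrix ι ι ℂ)) u = 0 := by
          rw [lieDer_single_kronecker_one]; exact sum_X_mul_pderiv_eq_zero_of_row_eq_zero hum hj i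
        have hcomm := lieDer_lieDer_sub (Matrix.single i j (1 : ℂ) ⊗ₖ (1 : Matrix ι ι ℂ))
          (Matrix.single j i (1 : ℂ) ⊗ₖ (1 : Matrix ι ι ℂ)) u
        rw [hEu, map_zero, sub_zero, single_kronecker_comm, lieDer_sub, Derivation.sub_apply,
          lieDer_single_kronecker_one i i u, lieDer_single_kronecker_one j j u,
          sum_X_mul_pderiv_row_of_isWeightedHomogeneous hum i,
          sum_X_mul_pderiv_row_of_isWeightedHomogeneous hum j, hj, Int.cast_zero, zero_smul,
          sub_zero] at hcomm
        have hmem : ((m.1 i : ℤ) : ℂ) • u ∈ T := by rw [← hcomm]; exact hTrow i j _ hFuT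
        have hne : ((m.1 i : ℤ) : ℂ) ≠ 0 := by exact_mod_cast (show m.1 i ≠ 0 by omega)
        exact (T.smul_mem_iff hne).mp hmem
  intro v hv
  have hcomp : ∀ m, weightedHomogeneousComponent (rcWeight ι) m v ∈ V := fun m =>
    weightedHomogeneousComponent_mem_of_stable V (fun i => hVrow i i) (fun j => hVcol j j) hv m
  rw [← sum_weightedHomogeneousComponent (rcWeight ι) v,
    finsum_eq_sum _ (weightedHomogeneousComponent_finsupp v)]
  exact T.sum_mem fun m _ => descent _ m (Nat.lt_succ_self _) _ (hcomp m)
    (weightedHomogeneousComponent_isWeightedHomogeneous m v)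

end Reduction

/-! ### §8 Assembly for `det_n`: `T̂_{[det_n]}𝒟ual_{2n−2,n,n²} ⊆ 𝔤𝔩(W)·det_n`, and `LMR2013_thm_3_1_1` -/

section KroneckerDet

variable {ι : Type*} [Fintype ι] [DecidableEq ι]

/-- **`(a ⊗ b)·det_n = det a · det b · det_n`**: the substitution `x ↦ aᵀ x b` of `GL(E)×GL(F)`
rescales the determinant (so `GL(E)×GL(F)` stabilises `[det_n]`).
[cite: LandsbergManivelRessayre2013, §3.4 (p. 478)] -/
theorem linSubst_kronecker_detPoly (a b : Matrix ι ι ℂ) :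
    linSubst (ι × ι) ℂ (a ⊗ₖ b) (detPoly ι ℂ) = (a.det * b.det) • detPoly ι ℂ := by
  have hmat : (linSubst (ι × ι) ℂ (a ⊗ₖ b) : MvPolynomial (ι × ι) ℂ →+*
        MvPolynomial (ι × ι) ℂ).mapMatrix (Matrix.mvPolynomialX ι ι ℂ) =
      (aᵀ).map (C : ℂ →+* MvPolynomial (ι × ι) ℂ) * Matrix.mvPolynomialX ι ι ℂ *
        b.map (C : ℂ →+* MvPolynomial (ι × ι) ℂ) := by
    refine Matrix.ext fun i j => ?_
    rw [RingHom.mapMatrix_apply, Matrix.map_apply, Matrix.mvPolynomialX_apply, RingHom.coe_coe,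
      linSubst_X]
    simp only [Matrix.mul_apply, Matrix.map_apply, Matrix.transpose_apply,
      Matrix.mvPolynomialX_apply, Matrix.kroneckerMap_apply, Finset.sum_mul]
    rw [Fintype.sum_prod_type, Finset.sum_comm]
    refine Finset.sum_congr rfl fun y _ => Finset.sum_congr rfl fun x _ => ?_
    rw [smul_eq_C_mul, map_mul]
    ring
  rw [show detPoly ι ℂ = (Matrix.mvPolynomialX ι ι ℂ).det from rfl,
    show linSubst (ι × ι) ℂ (a ⊗ₖ b) (Matrix.mvPolynomialX ι ι ℂ).det =
      ((linSubst (ι × ι) ℂ (a ⊗ₖ b) : MvPolynomial (ι × ι) ℂ →+* MvPolynomial (ι × ι) ℂ).mapMatrix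
        (Matrix.mvPolynomialX ι ι ℂ)).det from RingHom.map_det _ _,
    hmat, Matrix.det_mul, Matrix.det_mul]
  have h1 : (aᵀ.map (C : ℂ →+* MvPolynomial (ι × ι) ℂ)).det = C a.det := by
    rw [← RingHom.mapMatrix_apply, ← RingHom.map_det, Matrix.det_transpose]
  have h2 : (b.map (C : ℂ →+* MvPolynomial (ι × ι) ℂ)).det = C b.det := by
    rw [← RingHom.mapMatrix_apply, ← RingHom.map_det]
  rw [h1, h2, smul_eq_C_mul, map_mul]
  ring

/-- `det(1 + t E_{ij}) = 1 + t [i = j]` (a transvection for `i ≠ j`, a row scaling for `i = j`): the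
one-parameter subgroups of `GL(E)` used to differentiate the `GL(E)×GL(F)`-action of §3.4.
[cite: LandsbergManivelRessayre2013, §3.4 (p. 478)] -/
theorem det_one_add_smul_single (i j : ι) (t : ℂ) :
    ((1 : Matrix ι ι ℂ) + t • Matrix.single i j (1 : ℂ)).det = if i = j then 1 + t else 1 := by
  rw [Matrix.smul_single, smul_eq_mul, mul_one]
  by_cases hij : i = j
  · subst hij
    rw [if_pos rfl]
    have h : (1 : Matrix ι ι ℂ) + Matrix.single i i t =
        Matrix.diagonal fun k => if k = i then 1 + t else 1 := by
      refine Matrix.ext fun a b => ?_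
      rw [Matrix.add_apply, Matrix.one_apply, Matrix.single_apply, Matrix.diagonal_apply]
      by_cases hab : a = b
      · subst hab
        by_cases hai : a = i
        · subst hai; simp
        · simp [hai, Ne.symm hai]
      · have : ¬(i = a ∧ i = b) := fun h => hab (h.1.symm.trans h.2)
        simp [hab, this]
    rw [h, Matrix.det_diagonal, Finset.prod_ite_eq' Finset.univ i, if_pos (Finset.mem_univ i)]
  · rw [if_neg hij]
    exact Matrix.det_transvection_of_ne i j hij t

end KroneckerDet

section Assembly

/-- Row permutation of `Fin n × Fin n` as the product equivalence. [folklore] -/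
private theorem coe_prodCongr_refl_right {ι : Type*} (g : Equiv.Perm ι) :
    ⇑(Equiv.prodCongr g (Equiv.refl ι)) = Prod.map g id := rfl

/-- Column permutation of `Fin n × Fin n` as the product equivalence. [folklore] -/
private theorem coe_prodCongr_refl_left {ι : Type*} (g : Equiv.Perm ι) :
    ⇑(Equiv.prodCongr (Equiv.refl ι) g) = Prod.map id g := rfl

/-- **LMR 2013, Thm. 3.1.1, tangent clause `⊆` — PROVED**: for `n ≥ 3`,
`T̂_{[det_n]} 𝒟ual_{2n−2,n,n²} ⊆ 𝔤𝔩(W)·det_n` ("`T̂` … must be equal to `𝔤𝔩(W)·det_n`", p. 480).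
Route (ours): `T̂` is a `GL(E)×GL(F)`-submodule (`LMR13DualSchemeEquivariance`), hence stable under
the row/column derivations (`lieDer_mem_of_linSubst_mem`); by the weight reduction
(`le_of_rowCol_stable_of_weightOne`) it suffices to treat its `(1ⁿ;1ⁿ)`-weight vectors, which form a
two-sided ideal of `ℂ[𝔖_n]` (`permPoly`); such an ideal is generated by the `e_χ` it contains
(`le_of_forall_charIdempotent_mem`), `Φ(e_{χ_λ}) ∝ IM_λ`, and by Prop. 3.4.2
(`LMR2013_prop_3_4_2_holds`) the only immanants in `T̂` are `IM_{1ⁿ} = det_n` and `IM_{21^{n−2}}`, both in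
`𝔤𝔩(W)·det_n` (`LMR13ImmanantsTangent`). [cite: LandsbergManivelRessayre2013, Theorem 3.1.1 (p. 476, proof pp. 477–480)] -/
theorem lmrZariskiTangent_detPoly_subset_glTangent {n : ℕ} (hn : 3 ≤ n) :
    lmrZariskiTangent (2 * n - 2) n (detPoly (Fin n) ℂ) ⊆ ↑(glTangent (detPoly (Fin n) ℂ)) := by
  classical
  -- the Zariski tangent space as a submodule
  let W : Submodule ℂ (MvPolynomial (Fin n × Fin n) ℂ) :=
    { carrier := lmrZariskiTangent (2 * n - 2) n (detPoly (Fin n) ℂ)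
      zero_mem' := zero_mem_lmrZariskiTangent _ _ _
      add_mem' := fun {a b} ha hb => by simpa using smul_add_smul_mem_lmrZariskiTangent ha hb 1 1
      smul_mem' := fun c a ha => by
        simpa using smul_add_smul_mem_lmrZariskiTangent ha (zero_mem_lmrZariskiTangent _ _ _) c 0 }
  have hW : ∀ x, x ∈ W ↔ x ∈ lmrZariskiTangent (2 * n - 2) n (detPoly (Fin n) ℂ) := fun x => Iff.rfl
  -- group ⇒ Lie stability of `W` under the row and column operators
  have hU : ({t : ℂ | t ≠ -1}).Infinite := by
    have : ({t : ℂ | t ≠ -1}) = ({-1} : Set ℂ)ᶜ := by ext t; simp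
    rw [this]
    exact (Set.finite_singleton (-1 : ℂ)).infinite_compl
  have hc : ∀ (i j : Fin n) (t : ℂ), t ≠ -1 →
      ((1 : Matrix (Fin n) (Fin n) ℂ) + t • Matrix.single i j (1 : ℂ)).det ≠ 0 := by
    intro i j t ht
    rw [det_one_add_smul_single]
    split_ifs
    · intro h; exact ht (by linear_combination h)
    · exact one_ne_zero
  have hWrow : ∀ i j : Fin n, ∀ v ∈ W,
      lieDer (Matrix.single i j (1 : ℂ) ⊗ₖ (1 : Matrix (Fin n) (Fin n) ℂ)) v ∈ W := by
    intro i j v hv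
    refine lieDer_mem_of_linSubst_mem W _ hU (fun t ht w hw => ?_) hv
    have hM : linSubst (Fin n × Fin n) ℂ
        (1 + t • (Matrix.single i j (1 : ℂ) ⊗ₖ (1 : Matrix (Fin n) (Fin n) ℂ))) (detPoly (Fin n) ℂ) =
        (((1 : Matrix (Fin n) (Fin n) ℂ) + t • Matrix.single i j (1 : ℂ)).det) • detPoly (Fin n) ℂ := by
      rw [show (1 : Matrix (Fin n × Fin n) (Fin n × Fin n) ℂ) +
          t • (Matrix.single i j (1 : ℂ) ⊗ₖ (1 : Matrix (Fin n) (Fin n) ℂ)) =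
          ((1 : Matrix (Fin n) (Fin n) ℂ) + t • Matrix.single i j (1 : ℂ)) ⊗ₖ (1 : Matrix (Fin n) (Fin n) ℂ) by
            rw [Matrix.add_kronecker, Matrix.one_kronecker_one, Matrix.smul_kronecker],
        linSubst_kronecker_detPoly, Matrix.det_one, mul_one]
    exact (hW _).mpr (linSubst_mem_lmrZariskiTangent_of_linSubst_eq_smul _ (hc i j t ht) hM ((hW _).mp hw))
  have hWcol : ∀ i j : Fin n, ∀ v ∈ W,
      lieDer ((1 : Matrix (Fin n) (Fin n) ℂ) ⊗ₖ Matrix.single i j (1 : ℂ)) v ∈ W := by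
    intro i j v hv
    refine lieDer_mem_of_linSubst_mem W _ hU (fun t ht w hw => ?_) hv
    have hM : linSubst (Fin n × Fin n) ℂ
        (1 + t • ((1 : Matrix (Fin n) (Fin n) ℂ) ⊗ₖ Matrix.single i j (1 : ℂ))) (detPoly (Fin n) ℂ) =
        (((1 : Matrix (Fin n) (Fin n) ℂ) + t • Matrix.single i j (1 : ℂ)).det) • detPoly (Fin n) ℂ := by
      rw [show (1 : Matrix (Fin n × Fin n) (Fin n × Fin n) ℂ) +
          t • ((1 : Matrix (Fin n) (Fin n) ℂ) ⊗ₖ Matrix.single i j (1 : ℂ)) =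
          (1 : Matrix (Fin n) (Fin n) ℂ) ⊗ₖ ((1 : Matrix (Fin n) (Fin n) ℂ) + t • Matrix.single i j (1 : ℂ)) by
            rw [Matrix.kronecker_add, Matrix.one_kronecker_one, Matrix.kronecker_smul],
        linSubst_kronecker_detPoly, Matrix.det_one, one_mul]
    exact (hW _).mpr (linSubst_mem_lmrZariskiTangent_of_linSubst_eq_smul _ (hc i j t ht) hM ((hW _).mp hw))
  -- the weight reduction
  have hle : W ≤ glTangent (detPoly (Fin n) ℂ) := by
    refine le_of_rowCol_stable_of_weightOne ?_ hWrow hWcol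
      (fun i j p hp => lieDer_single_kronecker_one_mem_glTangent_detPoly i j hp)
      (fun i j p hp => lieDer_one_kronecker_single_mem_glTangent_detPoly i j hp) ?_
    · intro v hv
      simpa only [Fintype.card_fin] using ((hW v).mp hv).1
    · -- the `(1ⁿ;1ⁿ)`-weight vectors: two-sided ideals of `ℂ[𝔖_n]` and Prop. 3.4.2
      intro v hv hwt
      have hvr : v ∈ LinearMap.range (permPoly (Fin n)) := by
        rw [range_permPoly]; exact mem_span_permMonomial_of_isWeightedHomogeneous hwt
      obtain ⟨a, rfl⟩ := hvr
      have hsign : ∀ g : Equiv.Perm (Fin n), ((((Equiv.Perm.sign g : ℤˣ) : ℤ) : ℂ)) ≠ 0 := fun g =>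
        intCast_sign_ne_zero ℂ g
      have key : Submodule.comap (permPoly (Fin n)) W ≤
          Submodule.comap (permPoly (Fin n)) (glTangent (detPoly (Fin n) ℂ)) := by
        refine le_of_forall_charIdempotent_mem ?_ ?_ ?_ ?_
        · intro g x hx
          rw [Submodule.mem_comap] at hx ⊢
          rw [← rename_rowPerm_permPoly, ← coe_prodCongr_refl_right]
          refine (hW _).mpr (rename_mem_lmrZariskiTangent_of_rename_eq_smul _ (hsign g) ?_ ((hW _).mp hx))
          rw [coe_prodCongr_refl_right]; exact rename_rowPerm_detPoly g
        · intro g x hx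
          rw [Submodule.mem_comap] at hx ⊢
          rw [← inv_inv g, ← rename_colPerm_permPoly, ← coe_prodCongr_refl_left]
          refine (hW _).mpr (rename_mem_lmrZariskiTangent_of_rename_eq_smul _ (hsign g⁻¹) ?_ ((hW _).mp hx))
          rw [coe_prodCongr_refl_left]; exact rename_colPerm_detPoly g⁻¹
        · intro g x hx
          rw [Submodule.mem_comap] at hx ⊢
          rw [← inv_inv g, ← rename_colPerm_permPoly, ← coe_prodCongr_refl_left]
          refine rename_mem_glTangent_of_rename_eq_smul _
            (c := (((Equiv.Perm.sign g⁻¹ : ℤˣ) : ℤ) : ℂ)) ?_ hx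
          rw [coe_prodCongr_refl_left]; exact rename_colPerm_detPoly g⁻¹
        · intro χ hχ hI
          have hχ' : χ ∈ irrChars (Equiv.Perm (Fin n)) := hχ
          rw [irrChars_perm_eq] at hχ'
          obtain ⟨lam, rfl⟩ := hχ'
          rw [Submodule.mem_comap, permPoly_charIdempotent_spechtCharacter] at hI ⊢
          have hcoef : spechtCharacter ℂ lam 1 / (Fintype.card (Equiv.Perm (Fin n)) : ℂ) ≠ 0 :=
            div_ne_zero hχ.apply_one_ne_zero (Nat.cast_ne_zero.mpr Fintype.card_ne_zero)
          have hIM : immanant lam ∈ lmrZariskiTangent (2 * n - 2) n (detPoly (Fin n) ℂ) :=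
            (hW _).mp ((W.smul_mem_iff hcoef).mp hI)
          refine Submodule.smul_mem _ _ ?_
          rcases (LMR2013_prop_3_4_2_holds n hn lam).mp hIM with h | h
          · rw [eq_indiscrete_transpose_of_parts_eq h, immanant_indiscrete_transpose]
            exact detPoly_mem_glTangent (by omega)
          · rw [eq_twoRow_one_transpose_of_parts_eq hn h]
            exact immanant_twoRow_one_transpose_mem_glTangent (by omega)
      exact key (show a ∈ Submodule.comap (permPoly (Fin n)) W from hv)
  intro π hπ
  exact hle ((hW π).mpr hπ)

/-- **Landsberg–Manivel–Ressayre 2013, Theorem 3.1.1 — DISCHARGED** (`LMR2013_thm_3_1_1_holds`):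
"The scheme `𝒟ual_{2n−2,n,n²}` is smooth at `[det_n]`, and the `PGL_{n²}`-orbit closure of `[det_n]`
is an irreducible component of `𝒟ual_{2n−2,n,n²}`" — in the typed form (`n ≥ 3`):
`T̂_{[det_n]}𝒟ual = 𝔤𝔩(W)·det_n` and `Δ(det_n)` is an irreducible component of `𝒟ual_{2n−2,n,n²}`.
By `LMR2013_thm_3_1_1_iff_lmrZariskiTangent_subset` (the component clause from the tangent
inclusion, `LMR13ComponentFromTangent.lean`) and `lmrZariskiTangent_detPoly_subset_glTangent`.
Honest framing: a statement about the dual scheme of `det_n`; VP ≠ VNP is NOT proved.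
[cite: LandsbergManivelRessayre2013, Theorem 3.1.1 (p. 476)] -/
theorem LMR2013_thm_3_1_1_holds : LMR2013_thm_3_1_1 :=
  LMR2013_thm_3_1_1_iff_lmrZariskiTangent_subset.mpr fun _ hn =>
    lmrZariskiTangent_detPoly_subset_glTangent hn

/-- **`T̂_{[det_n]}𝒟ual_{2n−2,n,n²} = 𝔤𝔩(W)·det_n`** (`n ≥ 3`): the scheme `𝒟ual_{2n−2,n,n²}` is smooth at
`[det_n]` in the typed sense — both inclusions (`⊇`: `glTangent_detPoly_subset_lmrZariskiTangent`,
`LMR13ZariskiTangentProofs.lean`; `⊆`: `lmrZariskiTangent_detPoly_subset_glTangent`). "so `T̂` must be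
equal to `𝔤𝔩(W)·det_n`" (p. 480). [cite: LandsbergManivelRessayre2013, Theorem 3.1.1 (p. 476, proof p. 480)] -/
theorem lmrZariskiTangent_detPoly_eq_glTangent {n : ℕ} (hn : 3 ≤ n) :
    lmrZariskiTangent (2 * n - 2) n (detPoly (Fin n) ℂ) = ↑(glTangent (detPoly (Fin n) ℂ)) :=
  Set.Subset.antisymm (lmrZariskiTangent_detPoly_subset_glTangent hn)
    (glTangent_detPoly_subset_lmrZariskiTangent hn)

/-- **LMR 2013, Thm. 1.1.2 (2), UNCONDITIONAL** (`n ≥ 3`): "The variety `\overline{GL_{n²}·[det_n]}` is an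
irreducible component of the zero locus `𝒟_n` of `V_n`" — `Δ(det_n)` is an irreducible component of
`𝒟ual_{2n−2,n,n²}` (the typed `LMR2013_thm_1_1_2_2`, which takes `LMR2013_thm_3_1_1` as a hypothesis,
fed with `LMR2013_thm_3_1_1_holds`). [cite: LandsbergManivelRessayre2013, Theorem 1.1.2 (2) (p. 470)] -/
theorem orbitClosure_detPoly_isCoeffIrreducibleComponent {n : ℕ} (hn : 3 ≤ n) :
    IsCoeffIrreducibleComponent (orbitClosure (detPoly (Fin n) ℂ))
      (lmrDualScheme (σ := Fin n × Fin n) (2 * n - 2) n) :=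
  LMR2013_thm_1_1_2_2 LMR2013_thm_3_1_1_holds hn

end Assembly

end Literature.Computability.AlgebraicComplexity
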